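import Literature.Computability.AlgebraicComplexity.DDS21DiDILStep
import Literature.Computability.AlgebraicComplexity.DDS21WedgeWedgeToolkit
import HarnessLib

/-!
# DDS21 Thm 5.1: the exact DiDIL step for the bloated model `(ΠΣ∧/ΠΣ∧)·(Σ∧Σ∧/Σ∧Σ∧)` (brick B6-3)

K-side record layer (cell `val-lit`, brick **B6-3** of `HOME/np/MEMO-p1g10-DDS21-B6-Thm51-sizing.md`,
RULING (153) GO; the named fact `DDS2021_thm_5_1` stays OPEN by name — this file is its DiDIL record
layer only, it discharges nothing) for the de-bordering of `Σ^{[k]}ΠΣ∧` (Dutta–Dwivedi–Saxena,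
FOCS 2021, full version `paper:galaxy-pdf-7641649743695546420`, §5 Thm. 5.1 "proof sketch",
p0043 L1144 – p0045 L1: "We will go through the proof of Theorem 3.2 … and point out the important
changes for the DiDIL technique to work on this more general bloated-model
`(ΠΣ∧/ΠΣ∧)·(Σ∧Σ∧/Σ∧Σ∧)`" L1151–1153; "We will apply again divide and derive to reduce the fan-in
step by step" L1162–1163; Claim 5.2 "`T_{1,k−1} ∈ (ΠΣ∧/ΠΣ∧)·(Σ∧Σ∧/Σ∧Σ∧)` … of size at most
`s^{O(k7^k)}`" with its proof "`dlog(h) = −∂_z(z·B)/A · ∑_j (zB/A)^j` … `dlog(ΠΣ∧) ∈ Σ∧Σ∧` … the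
derivative of `Σ∧Σ∧` is again a `Σ∧Σ∧` circuit" L1164–1175; "the size and degree claims remain the
same" p0045 L1) [DuttaDwivediSaxena2022].

THIS FILE IS THE DECL-FOR-DECL TWIN of `DDS21DiDILStep.lean` (B4b, the `(ΠΣ/ΠΣ)·(Σ∧Σ/Σ∧Σ)` model
of Thm. 3.2) with the bottom `Σ` (affine forms `Option (Fin n) → K`, `affForm`, `formProd`)
replaced by the bottom `Σ∧` (`WForm K n = ⟨a, p⟩` with value `wedgeForm a p = a + ∑_m p_m(x_m)` of
`DDS21WedgeWedgeClass`, `wformProd`), and the certificate class `Σ∧Σ = swsClass K n t c` replaced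
by `Σ∧Σ∧ = swswClass K n t e δ` (B6-0/B6-1). What CHANGES relative to B4b:
* records `WFracPair`/`WPiRatio`/`WExactTerm` hold lists of `WForm K n`; the invertibility datum
  `a none ≠ 0` becomes `f.c0 ≠ 0` (`WForm.c0 f = a + ∑_m p_m(0)`, `WForm.coeff_zero_val`);
* a new invariant `DegForms δ` (all forms have univariate degrees `≤ δ`; forms are never created,
  so it propagates trivially: `degForms_divT/derT/didil/wdidilStep/wdidilIter`), and the size
  predicate `WBdd δ B D` books list lengths `≤ B`, numerator degrees `≤ D` and the coupling
  `δ·B ≤ D` (a product of `≤ B` forms has degree `≤ D`); the recursion is B4b's with the same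
  constants: `divT (2B, 2D)`, `derT (10B, 10D)`, `didil (20B, 20D)`, `wdidilIter (20^j B, 20^j D)`;
* certificates `WCert N t e δ` (graded pieces of `p/den` below degree `N` are `Σ∧Σ∧(t, e, δ)`
  circuits) carry an EXPONENT budget `e` (for `Σ∧Σ` the exponent of a degree-`c` piece is `c`; for
  `Σ∧Σ∧` it is not), propagated by B6-1's `mul_mem_swswClass` (`WCert.mul`: `(N t₁t₂(e₁+e₂+1),
  e₁+e₂)`), B4a's `gcomp_add/neg/C_mul/euler` (unchanged), and — the one new algebraic input,
  Claim 5.2 — B6-1's ★`gcomp_euler_wedgeForm_mem_swswClass` summed over the forms of a `ΠΣ∧`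
  product (`gcomp_euler_wformProd_mem_swswClass`, `WPiRatio.wcert_dlog`: top fan-in
  `(|num|+|den|)·N(N+1)(Nδ+1)`, exponents `≤ N`); the per-round budgets are the explicit functions
  `wDerTop`/`wDidilTop`/`wDidilExp` and the towers `wcertTop`/`wcertExp` (exactly what the
  propagation produces; closed-form monomial bounds are left to the assembly, as t18's SizeTower
  did for B4b).
What CARRIES OVER BY NAME (not restated): `ExtendsDer`, `extendsDer_eulerFrac`, `DegLE`,
`degLE_euler` (B4b); `euler`, `eulerFrac`, `gcomp` and its calculus (B4a); `wedgeForm`,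
`swswClass` and their toolkit (B6-0/B6-1). Values live in the same field
`FractionRing (MvPolynomial (Fin n) K)` and ★`sum_val_wdidilStep` is B4b's eq. (3.2) proof
verbatim (generic derivation pair; Euler instance `sum_val_wdidilStep_euler`).
What the LATER bricks will need (embargoed until the Thm 3.2 transcript seam is final, RULING
(153)(5)): B6-4 (E2/E3 twins: x5's `DDS21DiDILExactChain` is record-agnostic and applies as is to
`WExactTerm.val`; t19's end game needs `numPoly/denPoly/val_mul_denPoly` — here — and the
de-bordering of the last `Σ∧Σ∧`-certified fraction via B6-2 `DDS21WedgeWedgeReadOnce`), B6-5 (E4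
twin: genericity for `Σ∧` bottoms = `hα` of `exists_wstageZero`), B6-6 (assembly: t24's transcript
theorem is class-agnostic; budgets from `wcertTop`/`wcertExp`/`20^j`).

## Contents (definitions with bodies; every statement PROVED; no named facts)

* §1 `WForm` (`val`, `c0`, `DegLE`, `coeff_zero_val`, `val_ne_zero`, `totalDegree_val_le`,
  `eulerForm`/`euler_val`/`degLE_eulerForm`), `wformProd` (+ `nil/cons/append/ne_zero/ofFn`).
* §2 `WFracPair` (`den`, `val`, `ofPoly`, `mul`, `add`, `smul`, `neg`, `sub`, `der E₀` + `val_*`),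
  `WPiRatio` (`val`, `div`, `dlog`, `val_dlog`), `WExactTerm` (`val`, `WF`, `ND`, `val_eq_zero_iff`,
  `ofForms`, `smul`, `divT`, `derT`, `didil` + `wf/nd/val` lemmas), `wdidilStep`,
  ★`sum_val_wdidilStep` (eq. (3.2) exact) / `_euler`.
* §3 sizes: `totalDegree_wformProd_le` (`≤ δ·|L|`), `DegForms`, `WBdd δ B D`, `wbdd_divT/derT/didil`,
  `wbdd_wdidilStep`; `coeff_zero_wformProd(_ne_zero)`, `numPoly`/`denPoly`,
  `val_eq_numPoly_div_denPoly`, `val_mul_denPoly`.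
* §4 certificates: `sum_antidiagonal_mul_mem_swswClass`, `WFracPair.gc`/`WCert` with
  `mono/anti/mul/add/neg/sub/smul/der_euler`, `wcert_ofPoly_one`,
  ★`gcomp_euler_wformProd_mem_swswClass`, ★`WPiRatio.wcert_dlog` (Claim 5.2), `WExactTerm.WCert`
  with `wcert_ofForms/smul/divT/derT/didil`, `wcert_wdidilStep`.
* §5 iteration: `WChoice`, `wdidilIter` (`_zero/_succ`), `WDivisorsND`, `wf_wdidilIter`,
  `degForms_wdidilIter`, `wbdd_wdidilIter`, `wcertTop`/`wcertExp`, ★`wcert_wdidilIter`,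
  `sum_val_wdidilIter_succ`; stage `0`: `WLiveTerm`, `wofLiveTerm` (+ `val/wf/nd/wbdd/degForms/wcert`).
* §6 provenance (twin of B4b §8): `WExactTerm.FormsSat` + `imp`, `degForms_iff_formsSat`,
  projection lemmas, closure `FormsSat.smul/divT/derT/didil`, `formsSat_wdidilStep/wdidilIter`,
  `formsSat_wofLiveTerm`, ★`exists_wstageZero` (stage `0` as data with sizes, certificates,
  provenance AND shape), `sum_prod_eq_sum_prod_val` (the `spswClass` normal form read as `WForm` data).

Disclosed deviations from print (the same four as B4b, module docstring there, plus one):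
(i) `E = ∑ x_m ∂_m` (Euler) for `∂_z` after `Φ`; (ii) exact fractions, no truncation of the `dlog`
series ("`j < d₁`"); (iii) any nondegenerate term may be the divisor; (iv) division by `T`, not by
an `ε`-normalised `T̃` (`WExactTerm.smul` rescales); (v) budgets `(t, e, δ)` of `swswClass` instead
of one printed size `s` (SIZE CONVENTION of `DDS21WedgeWedgeClass`).

Honest framing: algebra plumbing for one brick of a published 2021 upper bound whose §5 is a
one-page sketch; `DDS2021_thm_5_1` / `DDS2021_thm_3_2` remain named facts (OPEN by name); nothing
here bears on VP versus VNP, which is NOT proved.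

## References

* [DuttaDwivediSaxena2022] P. Dutta, P. Dwivedi, N. Saxena, *Demystifying the border of depth-3
  algebraic circuits*, Proc. 62nd FOCS (2021), IEEE 2022, 92–103; full version §5 Thm. 5.1 with
  Claim 5.2 (p0043 L1144 – p0045 L1); §3 Divide and Derive (3.1)–(3.2) (p0029 L765–767, p0030
  L808–812), "Invertibility of ΠΣ-circuits" (p0031 L836–845), Claim 3.6 (p0032 L848 – p0033 L890),
  base case (p0028 L748–754); §2.3 `Σ∧Σ∧` remarks (p0020 L556–557, p0021 L568, p0022 L584).
-/

noncomputable section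

open MvPolynomial
open Finset.HasAntidiagonal (antidiagonal mem_antidiagonal)
open scoped BigOperators

namespace Literature.Computability.AlgebraicComplexity

namespace DDS2021

variable {K : Type*} [Field K] {n : ℕ}

/-! ### `Σ∧` forms as data -/

variable (K n) in
/-- A `Σ∧` form as DATA: a constant `a` and univariates `p_m`, with value
`wedgeForm a p = a + ∑_m p_m(x_m)` (`DDS21WedgeWedgeClass`); the bottom `Σ∧` of the `ΠΣ∧` products
and of the `Σ∧Σ∧` circuits of Thm. 5.1.
[cite: DuttaDwivediSaxena2022, §5 proof of Thm. 5.1, the bloated model `(ΠΣ∧/ΠΣ∧)·(Σ∧Σ∧/Σ∧Σ∧)` (full version p0043 L1151–1153)] -/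
structure WForm where
  /-- the constant term datum -/
  a : K
  /-- the univariate polynomials, one per variable -/
  p : Fin n → Polynomial K

namespace WForm

/-- The polynomial `a + ∑_m p_m(x_m)` of the form.
[cite: DuttaDwivediSaxena2022, §5 proof of Thm. 5.1 (full version p0043 L1151–1153)] -/
def val (f : WForm K n) : MvPolynomial (Fin n) K := wedgeForm f.a f.p

/-- The constant coefficient `a + ∑_m p_m(0)` of the form, as a datum (the "`A`" of
`h = A − z·B`, Claim 5.2). [cite: DuttaDwivediSaxena2022, Claim 5.2 proof (full version p0044 L1166–1171)] -/
def c0 (f : WForm K n) : K := f.a + ∑ m, (f.p m).coeff 0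

/-- Univariate degrees `≤ δ`. [cite: DuttaDwivediSaxena2022, Lemma 2.17 proof, "deg(g_i)·e ≤ D" (full version p0022 L597)] -/
def DegLE (δ : ℕ) (f : WForm K n) : Prop := ∀ m, (f.p m).natDegree ≤ δ

/-- `val_eq` (API of `Σ∧` forms). [cite: DuttaDwivediSaxena2022, §5 proof of Thm. 5.1 (full version p0043 L1151–1153)] -/
theorem val_eq (f : WForm K n) : f.val = wedgeForm f.a f.p := rfl

/-- `coeff_zero_val` (API of `Σ∧` forms). [cite: DuttaDwivediSaxena2022, Claim 5.2 proof (full version p0044 L1166–1171)] -/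
theorem coeff_zero_val (f : WForm K n) : coeff 0 f.val = f.c0 := coeff_zero_wedgeForm f.a f.p

/-- `val_ne_zero` (API of `Σ∧` forms). [cite: DuttaDwivediSaxena2022, Claim 5.2 proof, "0 ≠ A" (full version p0044 L1168)] -/
theorem val_ne_zero {f : WForm K n} (hf : f.c0 ≠ 0) : f.val ≠ 0 := by
  intro h
  apply hf
  rw [← coeff_zero_val f, h, coeff_zero]

/-- `totalDegree_val_le` (API of `Σ∧` forms). [cite: DuttaDwivediSaxena2022, Lemma 2.17 proof, "deg(g_i)·e ≤ D" (full version p0022 L597)] -/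
theorem totalDegree_val_le {δ : ℕ} {f : WForm K n} (hf : f.DegLE δ) : f.val.totalDegree ≤ δ :=
  totalDegree_wedgeForm_le f.a hf

/-- The Euler derivative of a `Σ∧` form as a `Σ∧` form: `E(a + ∑ p_m(x_m)) = ∑ x_m p_m'(x_m)`.
[cite: DuttaDwivediSaxena2022, Claim 5.2 proof, "∂_z(z·B)" (full version p0044 L1170–1171)] -/
def eulerForm (f : WForm K n) : WForm K n := ⟨0, fun m => Polynomial.X * Polynomial.derivative (f.p m)⟩

/-- `euler_val` (API of `Σ∧` forms). [cite: DuttaDwivediSaxena2022, Claim 5.2 proof, "∂_z(z·B)" (full version p0044 L1170–1171)] -/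
theorem euler_val (f : WForm K n) : euler (Fin n) K f.val = f.eulerForm.val :=
  euler_wedgeForm f.a f.p

/-- Degree bookkeeping for `X · q'`. [folklore] -/
private theorem natDegree_X_mul_derivative_le' {δ : ℕ} {q : Polynomial K} (hq : q.natDegree ≤ δ) :
    (Polynomial.X * Polynomial.derivative q).natDegree ≤ δ := by
  rcases Nat.eq_zero_or_pos q.natDegree with h0 | hpos
  · rw [Polynomial.derivative_of_natDegree_zero h0, mul_zero, Polynomial.natDegree_zero]
    exact Nat.zero_le _
  · refine Polynomial.natDegree_mul_le.trans ?_
    calc Polynomial.X.natDegree + (Polynomial.derivative q).natDegree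
        ≤ 1 + (q.natDegree - 1) :=
          Nat.add_le_add Polynomial.natDegree_X_le (Polynomial.natDegree_derivative_le q)
      _ = q.natDegree := by omega
      _ ≤ δ := hq

/-- `degLE_eulerForm` (API of `Σ∧` forms). [cite: DuttaDwivediSaxena2022, Claim 5.2 proof (full version p0044 L1166–1175)] -/
theorem degLE_eulerForm {δ : ℕ} {f : WForm K n} (hf : f.DegLE δ) : f.eulerForm.DegLE δ :=
  fun m => natDegree_X_mul_derivative_le' (hf m)

end WForm

/-- Product of the `Σ∧` forms of a list (a `ΠΣ∧` circuit).
[cite: DuttaDwivediSaxena2022, §5 proof of Thm. 5.1, `ΠΣ∧` (full version p0043 L1153–1156)] -/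
def wformProd (L : List (WForm K n)) : MvPolynomial (Fin n) K :=
  (L.map WForm.val).prod

/-- `wformProd_nil` (API). [cite: DuttaDwivediSaxena2022, §5 proof of Thm. 5.1, `ΠΣ∧` (full version p0043 L1153–1156)] -/
@[simp] theorem wformProd_nil : wformProd ([] : List (WForm K n)) = 1 := by
  simp [wformProd]

/-- `wformProd_cons` (API). [cite: DuttaDwivediSaxena2022, §5 proof of Thm. 5.1, `ΠΣ∧` (full version p0043 L1153–1156)] -/
@[simp] theorem wformProd_cons (a : WForm K n) (L : List (WForm K n)) :
    wformProd (a :: L) = a.val * wformProd L := by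
  simp [wformProd]

/-- `wformProd_append` (API). [cite: DuttaDwivediSaxena2022, §5 proof of Thm. 5.1, `ΠΣ∧` (full version p0043 L1153–1156)] -/
@[simp] theorem wformProd_append (L₁ L₂ : List (WForm K n)) :
    wformProd (L₁ ++ L₂) = wformProd L₁ * wformProd L₂ := by
  simp [wformProd, List.map_append, List.prod_append]

/-- `wformProd_ne_zero` (API). [cite: DuttaDwivediSaxena2022, §5 proof of Thm. 5.1, `ΠΣ∧` (full version p0043 L1153–1156)] -/
theorem wformProd_ne_zero {L : List (WForm K n)} (hL : ∀ a ∈ L, a.c0 ≠ 0) :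
    wformProd L ≠ 0 := by
  induction L with
  | nil => simp
  | cons a L ih =>
    rw [wformProd_cons]
    exact mul_ne_zero (WForm.val_ne_zero (hL a (by simp)))
      (ih fun b hb => hL b (by simp [hb]))

/-- `wformProd_ofFn` (API): `wformProd (List.ofFn g) = ∏_j (g j).val` (the terms `∏_j g_{ij}` of a
`Σ^{[k]}ΠΣ∧` circuit, `spswClass` data). [cite: DuttaDwivediSaxena2022, §5 Thm. 5.1 (full version p0043 L1144–1150)] -/
theorem wformProd_ofFn {d : ℕ} (g : Fin d → WForm K n) :
    wformProd (List.ofFn g) = ∏ j, (g j).val := by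
  rw [wformProd, List.map_ofFn, List.prod_ofFn]
  rfl

/-! ### Fractions `p / Π` with `Π` a product of invertible affine forms -/

variable (K n) in
/-- A fraction `p / ∏_{a ∈ L} WForm.val a` of the rational function field `K(x)`, given by a
numerator polynomial `p` and a list `L` of affine forms with nonzero constant terms.
[cite: DuttaDwivediSaxena2022, §3 proof of Thm. 3.2, the terms `(U/V)·(P/Q)` of the DiDIL induction and Claim 3.6 (full version p0030 L801–805, p0031 L836–845, p0032 L848–850)] -/
structure WFracPair where
  /-- numerator -/
  p : MvPolynomial (Fin n) K
  /-- the denominator, as a list of affine-form data -/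
  L : List (WForm K n)
  /-- every listed form has a nonzero constant term -/
  hL : ∀ a ∈ L, a.c0 ≠ 0

namespace WFracPair

/-- The denominator polynomial `∏_{a ∈ L} WForm.val a`.
[cite: DuttaDwivediSaxena2022, §3 proof of Thm. 3.2, the terms `(U/V)·(P/Q)` of the DiDIL induction and Claim 3.6 (full version p0030 L801–805, p0031 L836–845, p0032 L848–850)] -/
def den (P : WFracPair K n) : MvPolynomial (Fin n) K := wformProd P.L

/-- `den_ne_zero` (API of the exact DiDIL objects). [cite: DuttaDwivediSaxena2022, §3 proof of Thm. 3.2, the terms `(U/V)·(P/Q)` of the DiDIL induction and Claim 3.6 (full version p0030 L801–805, p0031 L836–845, p0032 L848–850)] -/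
theorem den_ne_zero (P : WFracPair K n) : P.den ≠ 0 := wformProd_ne_zero P.hL

/-- The value `p / den` in the fraction field `K(x)`.
[cite: DuttaDwivediSaxena2022, §3 proof of Thm. 3.2, the terms `(U/V)·(P/Q)` of the DiDIL induction and Claim 3.6 (full version p0030 L801–805, p0031 L836–845, p0032 L848–850)] -/
def val (P : WFracPair K n) : FractionRing (MvPolynomial (Fin n) K) :=
  algebraMap (MvPolynomial (Fin n) K) (FractionRing (MvPolynomial (Fin n) K)) P.p /
    algebraMap (MvPolynomial (Fin n) K) (FractionRing (MvPolynomial (Fin n) K)) P.den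

/-- `algebraMap_den_ne_zero` (API of the exact DiDIL objects). [cite: DuttaDwivediSaxena2022, §3 proof of Thm. 3.2, the terms `(U/V)·(P/Q)` of the DiDIL induction and Claim 3.6 (full version p0030 L801–805, p0031 L836–845, p0032 L848–850)] -/
theorem algebraMap_den_ne_zero (P : WFracPair K n) :
    algebraMap (MvPolynomial (Fin n) K) (FractionRing (MvPolynomial (Fin n) K)) P.den ≠ 0 :=
  fun h => P.den_ne_zero ((IsFractionRing.injective _ _) (by rw [h, map_zero]))

/-- The polynomial `p` as a fraction `p / 1`.
[cite: DuttaDwivediSaxena2022, §3 proof of Thm. 3.2, the terms `(U/V)·(P/Q)` of the DiDIL induction and Claim 3.6 (full version p0030 L801–805, p0031 L836–845, p0032 L848–850)] -/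
def ofPoly (p : MvPolynomial (Fin n) K) : WFracPair K n := ⟨p, [], by simp⟩

/-- `ofPoly_p` (API of the exact DiDIL objects). [cite: DuttaDwivediSaxena2022, §3 proof of Thm. 3.2, the terms `(U/V)·(P/Q)` of the DiDIL induction and Claim 3.6 (full version p0030 L801–805, p0031 L836–845, p0032 L848–850)] -/
@[simp] theorem ofPoly_p (p : MvPolynomial (Fin n) K) : (ofPoly p).p = p := rfl
/-- `ofPoly_L` (API of the exact DiDIL objects). [cite: DuttaDwivediSaxena2022, §3 proof of Thm. 3.2, the terms `(U/V)·(P/Q)` of the DiDIL induction and Claim 3.6 (full version p0030 L801–805, p0031 L836–845, p0032 L848–850)] -/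
@[simp] theorem ofPoly_L (p : MvPolynomial (Fin n) K) : (ofPoly p).L = [] := rfl

/-- `den_ofPoly` (API of the exact DiDIL objects). [cite: DuttaDwivediSaxena2022, §3 proof of Thm. 3.2, the terms `(U/V)·(P/Q)` of the DiDIL induction and Claim 3.6 (full version p0030 L801–805, p0031 L836–845, p0032 L848–850)] -/
theorem den_ofPoly (p : MvPolynomial (Fin n) K) : (ofPoly p).den = 1 := by simp [den, ofPoly]

/-- `val_ofPoly` (API of the exact DiDIL objects). [cite: DuttaDwivediSaxena2022, §3 proof of Thm. 3.2, the terms `(U/V)·(P/Q)` of the DiDIL induction and Claim 3.6 (full version p0030 L801–805, p0031 L836–845, p0032 L848–850)] -/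
theorem val_ofPoly (p : MvPolynomial (Fin n) K) :
    (ofPoly p).val = algebraMap (MvPolynomial (Fin n) K) (FractionRing (MvPolynomial (Fin n) K)) p := by
  rw [val, den_ofPoly, map_one, div_one, ofPoly_p]

/-- Product of two fractions: numerators multiply, form lists concatenate.
[cite: DuttaDwivediSaxena2022, §3 proof of Thm. 3.2, the terms `(U/V)·(P/Q)` of the DiDIL induction and Claim 3.6 (full version p0030 L801–805, p0031 L836–845, p0032 L848–850)] -/
def mul (P Q : WFracPair K n) : WFracPair K n :=
  ⟨P.p * Q.p, P.L ++ Q.L, fun a ha => by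
    rcases List.mem_append.1 ha with h | h
    · exact P.hL a h
    · exact Q.hL a h⟩

/-- `mul_p` (API of the exact DiDIL objects). [cite: DuttaDwivediSaxena2022, §3 proof of Thm. 3.2, the terms `(U/V)·(P/Q)` of the DiDIL induction and Claim 3.6 (full version p0030 L801–805, p0031 L836–845, p0032 L848–850)] -/
@[simp] theorem mul_p (P Q : WFracPair K n) : (P.mul Q).p = P.p * Q.p := rfl
/-- `mul_L` (API of the exact DiDIL objects). [cite: DuttaDwivediSaxena2022, §3 proof of Thm. 3.2, the terms `(U/V)·(P/Q)` of the DiDIL induction and Claim 3.6 (full version p0030 L801–805, p0031 L836–845, p0032 L848–850)] -/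
@[simp] theorem mul_L (P Q : WFracPair K n) : (P.mul Q).L = P.L ++ Q.L := rfl

/-- `den_mul` (API of the exact DiDIL objects). [cite: DuttaDwivediSaxena2022, §3 proof of Thm. 3.2, the terms `(U/V)·(P/Q)` of the DiDIL induction and Claim 3.6 (full version p0030 L801–805, p0031 L836–845, p0032 L848–850)] -/
theorem den_mul (P Q : WFracPair K n) : (P.mul Q).den = P.den * Q.den := by
  simp [den, mul]

/-- `val_mul` (API of the exact DiDIL objects). [cite: DuttaDwivediSaxena2022, §3 proof of Thm. 3.2, the terms `(U/V)·(P/Q)` of the DiDIL induction and Claim 3.6 (full version p0030 L801–805, p0031 L836–845, p0032 L848–850)] -/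
theorem val_mul (P Q : WFracPair K n) : (P.mul Q).val = P.val * Q.val := by
  rw [val, val, val, mul_p, den_mul, map_mul, map_mul, div_mul_div_comm]

/-- Sum of two fractions over the concatenated form list.
[cite: DuttaDwivediSaxena2022, §3 proof of Thm. 3.2, the terms `(U/V)·(P/Q)` of the DiDIL induction and Claim 3.6 (full version p0030 L801–805, p0031 L836–845, p0032 L848–850)] -/
def add (P Q : WFracPair K n) : WFracPair K n :=
  ⟨P.p * Q.den + Q.p * P.den, P.L ++ Q.L, fun a ha => by
    rcases List.mem_append.1 ha with h | h
    · exact P.hL a h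
    · exact Q.hL a h⟩

/-- `add_p` (API of the exact DiDIL objects). [cite: DuttaDwivediSaxena2022, §3 proof of Thm. 3.2, the terms `(U/V)·(P/Q)` of the DiDIL induction and Claim 3.6 (full version p0030 L801–805, p0031 L836–845, p0032 L848–850)] -/
@[simp] theorem add_p (P Q : WFracPair K n) : (P.add Q).p = P.p * Q.den + Q.p * P.den := rfl
/-- `add_L` (API of the exact DiDIL objects). [cite: DuttaDwivediSaxena2022, §3 proof of Thm. 3.2, the terms `(U/V)·(P/Q)` of the DiDIL induction and Claim 3.6 (full version p0030 L801–805, p0031 L836–845, p0032 L848–850)] -/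
@[simp] theorem add_L (P Q : WFracPair K n) : (P.add Q).L = P.L ++ Q.L := rfl

/-- `den_add` (API of the exact DiDIL objects). [cite: DuttaDwivediSaxena2022, §3 proof of Thm. 3.2, the terms `(U/V)·(P/Q)` of the DiDIL induction and Claim 3.6 (full version p0030 L801–805, p0031 L836–845, p0032 L848–850)] -/
theorem den_add (P Q : WFracPair K n) : (P.add Q).den = P.den * Q.den := by
  simp [den, add]

/-- `val_add` (API of the exact DiDIL objects). [cite: DuttaDwivediSaxena2022, §3 proof of Thm. 3.2, the terms `(U/V)·(P/Q)` of the DiDIL induction and Claim 3.6 (full version p0030 L801–805, p0031 L836–845, p0032 L848–850)] -/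
theorem val_add (P Q : WFracPair K n) : (P.add Q).val = P.val + Q.val := by
  rw [val, val, val, add_p, den_add, map_add, map_mul, map_mul, map_mul,
    div_add_div _ _ P.algebraMap_den_ne_zero Q.algebraMap_den_ne_zero]
  ring

/-- Scalar multiple `c · (p/Π) = (c p)/Π`.
[cite: DuttaDwivediSaxena2022, §3 proof of Thm. 3.2, the terms `(U/V)·(P/Q)` of the DiDIL induction and Claim 3.6 (full version p0030 L801–805, p0031 L836–845, p0032 L848–850)] -/
def smul (c : K) (P : WFracPair K n) : WFracPair K n := ⟨C c * P.p, P.L, P.hL⟩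

/-- `smul_p` (API of the exact DiDIL objects). [cite: DuttaDwivediSaxena2022, §3 proof of Thm. 3.2, the terms `(U/V)·(P/Q)` of the DiDIL induction and Claim 3.6 (full version p0030 L801–805, p0031 L836–845, p0032 L848–850)] -/
@[simp] theorem smul_p (c : K) (P : WFracPair K n) : (P.smul c).p = C c * P.p := rfl
/-- `smul_L` (API of the exact DiDIL objects). [cite: DuttaDwivediSaxena2022, §3 proof of Thm. 3.2, the terms `(U/V)·(P/Q)` of the DiDIL induction and Claim 3.6 (full version p0030 L801–805, p0031 L836–845, p0032 L848–850)] -/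
@[simp] theorem smul_L (c : K) (P : WFracPair K n) : (P.smul c).L = P.L := rfl

/-- `den_smul` (API of the exact DiDIL objects). [cite: DuttaDwivediSaxena2022, §3 proof of Thm. 3.2, the terms `(U/V)·(P/Q)` of the DiDIL induction and Claim 3.6 (full version p0030 L801–805, p0031 L836–845, p0032 L848–850)] -/
theorem den_smul (c : K) (P : WFracPair K n) : (P.smul c).den = P.den := rfl

/-- `val_smul` (API of the exact DiDIL objects). [cite: DuttaDwivediSaxena2022, §3 proof of Thm. 3.2, the terms `(U/V)·(P/Q)` of the DiDIL induction and Claim 3.6 (full version p0030 L801–805, p0031 L836–845, p0032 L848–850)] -/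
theorem val_smul (c : K) (P : WFracPair K n) :
    (P.smul c).val =
      algebraMap (MvPolynomial (Fin n) K) (FractionRing (MvPolynomial (Fin n) K)) (C c) * P.val := by
  rw [val, val, smul_p, den_smul, map_mul, mul_div_assoc]

/-- Negation.
[cite: DuttaDwivediSaxena2022, §3 proof of Thm. 3.2, the terms `(U/V)·(P/Q)` of the DiDIL induction and Claim 3.6 (full version p0030 L801–805, p0031 L836–845, p0032 L848–850)] -/
def neg (P : WFracPair K n) : WFracPair K n := ⟨-P.p, P.L, P.hL⟩

/-- `neg_p` (API of the exact DiDIL objects). [cite: DuttaDwivediSaxena2022, §3 proof of Thm. 3.2, the terms `(U/V)·(P/Q)` of the DiDIL induction and Claim 3.6 (full version p0030 L801–805, p0031 L836–845, p0032 L848–850)] -/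
@[simp] theorem neg_p (P : WFracPair K n) : P.neg.p = -P.p := rfl
/-- `neg_L` (API of the exact DiDIL objects). [cite: DuttaDwivediSaxena2022, §3 proof of Thm. 3.2, the terms `(U/V)·(P/Q)` of the DiDIL induction and Claim 3.6 (full version p0030 L801–805, p0031 L836–845, p0032 L848–850)] -/
@[simp] theorem neg_L (P : WFracPair K n) : P.neg.L = P.L := rfl

/-- `den_neg` (API of the exact DiDIL objects). [cite: DuttaDwivediSaxena2022, §3 proof of Thm. 3.2, the terms `(U/V)·(P/Q)` of the DiDIL induction and Claim 3.6 (full version p0030 L801–805, p0031 L836–845, p0032 L848–850)] -/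
theorem den_neg (P : WFracPair K n) : P.neg.den = P.den := rfl

/-- `val_neg` (API of the exact DiDIL objects). [cite: DuttaDwivediSaxena2022, §3 proof of Thm. 3.2, the terms `(U/V)·(P/Q)` of the DiDIL induction and Claim 3.6 (full version p0030 L801–805, p0031 L836–845, p0032 L848–850)] -/
theorem val_neg (P : WFracPair K n) : P.neg.val = -P.val := by
  rw [val, val, neg_p, den_neg, map_neg, neg_div]

/-- Difference.
[cite: DuttaDwivediSaxena2022, §3 proof of Thm. 3.2, the terms `(U/V)·(P/Q)` of the DiDIL induction and Claim 3.6 (full version p0030 L801–805, p0031 L836–845, p0032 L848–850)] -/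
def sub (P Q : WFracPair K n) : WFracPair K n := P.add Q.neg

/-- `val_sub` (API of the exact DiDIL objects). [cite: DuttaDwivediSaxena2022, §3 proof of Thm. 3.2, the terms `(U/V)·(P/Q)` of the DiDIL induction and Claim 3.6 (full version p0030 L801–805, p0031 L836–845, p0032 L848–850)] -/
theorem val_sub (P Q : WFracPair K n) : (P.sub Q).val = P.val - Q.val := by
  rw [sub, val_add, val_neg, sub_eq_add_neg]

/-- `sub_L` (API of the exact DiDIL objects). [cite: DuttaDwivediSaxena2022, §3 proof of Thm. 3.2, the terms `(U/V)·(P/Q)` of the DiDIL induction and Claim 3.6 (full version p0030 L801–805, p0031 L836–845, p0032 L848–850)] -/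
@[simp] theorem sub_L (P Q : WFracPair K n) : (P.sub Q).L = P.L ++ Q.L := rfl

/-- `sub_p` (API of the exact DiDIL objects). [cite: DuttaDwivediSaxena2022, §3 proof of Thm. 3.2, the terms `(U/V)·(P/Q)` of the DiDIL induction and Claim 3.6 (full version p0030 L801–805, p0031 L836–845, p0032 L848–850)] -/
theorem sub_p (P Q : WFracPair K n) : (P.sub Q).p = P.p * Q.den - Q.p * P.den := by
  simp [sub, add, neg, den, sub_eq_add_neg]

/-- The image of a fraction under a derivation `E₀` of `K[x]` (quotient rule):
`E(p/Π) = (E p · Π − p · E Π) / Π²`.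
[cite: DuttaDwivediSaxena2022, §3 proof of Thm. 3.2, Divide and Derive, eq. (3.2) and `T_{i,j+1} := (T_{i,j}/T̃_{k-j,j})·dlog(T_{i,j}/T̃_{k-j,j})` (full version p0030 L808–812, p0031 L815–817)] -/
def der (E₀ : Derivation K (MvPolynomial (Fin n) K) (MvPolynomial (Fin n) K)) (P : WFracPair K n) :
    WFracPair K n :=
  ⟨E₀ P.p * P.den - P.p * E₀ P.den, P.L ++ P.L, fun a ha => by
    rcases List.mem_append.1 ha with h | h
    · exact P.hL a h
    · exact P.hL a h⟩

/-- `der_p` (API of the exact DiDIL objects). [cite: DuttaDwivediSaxena2022, §3 proof of Thm. 3.2, Divide and Derive, eq. (3.2) and `T_{i,j+1} := (T_{i,j}/T̃_{k-j,j})·dlog(T_{i,j}/T̃_{k-j,j})` (full version p0030 L808–812, p0031 L815–817)] -/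
@[simp] theorem der_p (E₀ : Derivation K (MvPolynomial (Fin n) K) (MvPolynomial (Fin n) K))
    (P : WFracPair K n) : (P.der E₀).p = E₀ P.p * P.den - P.p * E₀ P.den := rfl
/-- `der_L` (API of the exact DiDIL objects). [cite: DuttaDwivediSaxena2022, §3 proof of Thm. 3.2, Divide and Derive, eq. (3.2) and `T_{i,j+1} := (T_{i,j}/T̃_{k-j,j})·dlog(T_{i,j}/T̃_{k-j,j})` (full version p0030 L808–812, p0031 L815–817)] -/
@[simp] theorem der_L (E₀ : Derivation K (MvPolynomial (Fin n) K) (MvPolynomial (Fin n) K))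
    (P : WFracPair K n) : (P.der E₀).L = P.L ++ P.L := rfl

/-- `den_der` (API of the exact DiDIL objects). [cite: DuttaDwivediSaxena2022, §3 proof of Thm. 3.2, Divide and Derive, eq. (3.2) and `T_{i,j+1} := (T_{i,j}/T̃_{k-j,j})·dlog(T_{i,j}/T̃_{k-j,j})` (full version p0030 L808–812, p0031 L815–817)] -/
theorem den_der (E₀ : Derivation K (MvPolynomial (Fin n) K) (MvPolynomial (Fin n) K))
    (P : WFracPair K n) : (P.der E₀).den = P.den * P.den := by
  simp [den, der]

end WFracPair

/-! ### Values of derivatives (the derivation pair `ExtendsDer` of `DDS21DiDILStep`) -/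

namespace WFracPair

/-- `val_der` (API of the exact DiDIL objects). [cite: DuttaDwivediSaxena2022, §3 proof of Thm. 3.2, Divide and Derive, eq. (3.2) and `T_{i,j+1} := (T_{i,j}/T̃_{k-j,j})·dlog(T_{i,j}/T̃_{k-j,j})` (full version p0030 L808–812, p0031 L815–817)] -/
theorem val_der {E₀ : Derivation K (MvPolynomial (Fin n) K) (MvPolynomial (Fin n) K)}
    {D : Derivation K (FractionRing (MvPolynomial (Fin n) K))
      (FractionRing (MvPolynomial (Fin n) K))}
    (hD : ExtendsDer K n E₀ D) (P : WFracPair K n) : (P.der E₀).val = D P.val := by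
  have hden := P.algebraMap_den_ne_zero
  rw [val, val, der_p, den_der, D.leibniz_div, map_sub, map_mul, map_mul, map_mul, ← hD, ← hD]
  simp only [smul_eq_mul]
  field_simp

end WFracPair


/-! ### `ΠΣ`-ratios `κ · ∏ ℓ / ∏ ℓ'` of invertible affine forms -/

variable (K n) in
/-- A ratio `κ · (∏_{a ∈ num} WForm.val a) / (∏_{a ∈ den} WForm.val a)` of products of affine forms with
nonzero constant terms, `κ ≠ 0` (the `U/V` part of a bloated term, with its scalar).
[cite: DuttaDwivediSaxena2022, §3 proof of Thm. 3.2, "Invertibility of `ΠΣ`-circuits", `U_{i,j+1} := ε^{-a}·U_{i,j}·V_{k-j,j}`, `V_{i,j+1} := V_{i,j}·U_{k-j,j}` (full version p0031 L836–845)] -/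
structure WPiRatio where
  /-- the scalar -/
  κ : K
  /-- numerator forms -/
  num : List (WForm K n)
  /-- denominator forms -/
  den : List (WForm K n)
  hκ : κ ≠ 0
  hnum : ∀ a ∈ num, a.c0 ≠ 0
  hden : ∀ a ∈ den, a.c0 ≠ 0

namespace WPiRatio

/-- The value `κ · ∏ num / ∏ den` in `K(x)`.
[cite: DuttaDwivediSaxena2022, §3 proof of Thm. 3.2, "Invertibility of `ΠΣ`-circuits", `U_{i,j+1} := ε^{-a}·U_{i,j}·V_{k-j,j}`, `V_{i,j+1} := V_{i,j}·U_{k-j,j}` (full version p0031 L836–845)] -/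
def val (A : WPiRatio K n) : FractionRing (MvPolynomial (Fin n) K) :=
  algebraMap (MvPolynomial (Fin n) K) (FractionRing (MvPolynomial (Fin n) K)) (C A.κ * wformProd A.num) /
    algebraMap (MvPolynomial (Fin n) K) (FractionRing (MvPolynomial (Fin n) K)) (wformProd A.den)

/-- `algebraMap_num_ne_zero` (API of the exact DiDIL objects). [cite: DuttaDwivediSaxena2022, §3 proof of Thm. 3.2, "Invertibility of `ΠΣ`-circuits", `U_{i,j+1} := ε^{-a}·U_{i,j}·V_{k-j,j}`, `V_{i,j+1} := V_{i,j}·U_{k-j,j}` (full version p0031 L836–845)] -/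
theorem algebraMap_num_ne_zero (A : WPiRatio K n) :
    algebraMap (MvPolynomial (Fin n) K) (FractionRing (MvPolynomial (Fin n) K))
      (C A.κ * wformProd A.num) ≠ 0 :=
  fun h => (mul_ne_zero (C_eq_zero.not.2 A.hκ) (wformProd_ne_zero A.hnum))
    ((IsFractionRing.injective _ _) (by rw [h, map_zero]))

/-- `algebraMap_den_ne_zero` (API of the exact DiDIL objects). [cite: DuttaDwivediSaxena2022, §3 proof of Thm. 3.2, "Invertibility of `ΠΣ`-circuits", `U_{i,j+1} := ε^{-a}·U_{i,j}·V_{k-j,j}`, `V_{i,j+1} := V_{i,j}·U_{k-j,j}` (full version p0031 L836–845)] -/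
theorem algebraMap_den_ne_zero (A : WPiRatio K n) :
    algebraMap (MvPolynomial (Fin n) K) (FractionRing (MvPolynomial (Fin n) K)) (wformProd A.den) ≠ 0 :=
  fun h => (wformProd_ne_zero A.hden) ((IsFractionRing.injective _ _) (by rw [h, map_zero]))

/-- `val_ne_zero` (API of the exact DiDIL objects). [cite: DuttaDwivediSaxena2022, §3 proof of Thm. 3.2, "Invertibility of `ΠΣ`-circuits", `U_{i,j+1} := ε^{-a}·U_{i,j}·V_{k-j,j}`, `V_{i,j+1} := V_{i,j}·U_{k-j,j}` (full version p0031 L836–845)] -/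
theorem val_ne_zero (A : WPiRatio K n) : A.val ≠ 0 :=
  div_ne_zero A.algebraMap_num_ne_zero A.algebraMap_den_ne_zero

/-- Quotient of two `ΠΣ`-ratios (the `U_{i,j+1}/V_{i,j+1}` of the DiDIL step: numerator lists and
denominator lists are concatenated crosswise, scalars divide).
[cite: DuttaDwivediSaxena2022, §3 proof of Thm. 3.2, "Invertibility of `ΠΣ`-circuits", `U_{i,j+1} := ε^{-a}·U_{i,j}·V_{k-j,j}`, `V_{i,j+1} := V_{i,j}·U_{k-j,j}` (full version p0031 L836–845)] -/
def div (A B : WPiRatio K n) : WPiRatio K n where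
  κ := A.κ / B.κ
  num := A.num ++ B.den
  den := A.den ++ B.num
  hκ := div_ne_zero A.hκ B.hκ
  hnum := fun a ha => by
    rcases List.mem_append.1 ha with h | h
    · exact A.hnum a h
    · exact B.hden a h
  hden := fun a ha => by
    rcases List.mem_append.1 ha with h | h
    · exact A.hden a h
    · exact B.hnum a h

/-- `val_div` (API of the exact DiDIL objects). [cite: DuttaDwivediSaxena2022, §3 proof of Thm. 3.2, "Invertibility of `ΠΣ`-circuits", `U_{i,j+1} := ε^{-a}·U_{i,j}·V_{k-j,j}`, `V_{i,j+1} := V_{i,j}·U_{k-j,j}` (full version p0031 L836–845)] -/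
theorem val_div (A B : WPiRatio K n) : (A.div B).val = A.val / B.val := by
  have h1 := A.algebraMap_den_ne_zero
  have h2 := B.algebraMap_den_ne_zero
  have h3 := B.algebraMap_num_ne_zero
  have hκB : algebraMap (MvPolynomial (Fin n) K) (FractionRing (MvPolynomial (Fin n) K)) (C B.κ) ≠ 0 :=
    fun h => (C_eq_zero.not.2 B.hκ) ((IsFractionRing.injective _ _) (by rw [h, map_zero]))
  rw [map_mul] at h3
  have hC : algebraMap (MvPolynomial (Fin n) K) (FractionRing (MvPolynomial (Fin n) K)) (C (A.κ / B.κ)) =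
      algebraMap (MvPolynomial (Fin n) K) (FractionRing (MvPolynomial (Fin n) K)) (C A.κ) /
        algebraMap (MvPolynomial (Fin n) K) (FractionRing (MvPolynomial (Fin n) K)) (C B.κ) := by
    rw [eq_div_iff hκB, ← map_mul, ← C_mul, div_mul_cancel₀ _ B.hκ]
  simp only [val, div, wformProd_append, map_mul, hC]
  field_simp

/-- The logarithmic derivative `E₀(val A) / val A = E₀(∏num)/∏num − E₀(∏den)/∏den` of a `ΠΣ`-ratio,
as a fraction over the forms of `A`.
[cite: DuttaDwivediSaxena2022, §3 proof of Thm. 3.2, eq. (3.3) and "dlog distributes the product additively … dlog(ΠΣ/ΠΣ) ∈ Σ dlog(Σ)" (full version p0031 L836–838, p0032 L854–862, p0033 L873–877)] -/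
def dlog (E₀ : Derivation K (MvPolynomial (Fin n) K) (MvPolynomial (Fin n) K)) (A : WPiRatio K n) :
    WFracPair K n :=
  (⟨E₀ (wformProd A.num), A.num, A.hnum⟩ : WFracPair K n).sub ⟨E₀ (wformProd A.den), A.den, A.hden⟩

/-- `dlog_L` (API of the exact DiDIL objects). [cite: DuttaDwivediSaxena2022, §3 proof of Thm. 3.2, eq. (3.3) and "dlog distributes the product additively … dlog(ΠΣ/ΠΣ) ∈ Σ dlog(Σ)" (full version p0031 L836–838, p0032 L854–862, p0033 L873–877)] -/
@[simp] theorem dlog_L (E₀ : Derivation K (MvPolynomial (Fin n) K) (MvPolynomial (Fin n) K))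
    (A : WPiRatio K n) : (A.dlog E₀).L = A.num ++ A.den := rfl

/-- `val_dlog` (API of the exact DiDIL objects). [cite: DuttaDwivediSaxena2022, §3 proof of Thm. 3.2, eq. (3.3) and "dlog distributes the product additively … dlog(ΠΣ/ΠΣ) ∈ Σ dlog(Σ)" (full version p0031 L836–838, p0032 L854–862, p0033 L873–877)] -/
theorem val_dlog {E₀ : Derivation K (MvPolynomial (Fin n) K) (MvPolynomial (Fin n) K)}
    {D : Derivation K (FractionRing (MvPolynomial (Fin n) K))
      (FractionRing (MvPolynomial (Fin n) K))}
    (hD : ExtendsDer K n E₀ D) (A : WPiRatio K n) : (A.dlog E₀).val = D A.val / A.val := by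
  have h1 := A.algebraMap_den_ne_zero
  have h3 := A.algebraMap_num_ne_zero
  have hκ : algebraMap (MvPolynomial (Fin n) K) (FractionRing (MvPolynomial (Fin n) K)) (C A.κ) ≠ 0 :=
    fun h => (C_eq_zero.not.2 A.hκ) ((IsFractionRing.injective _ _) (by rw [h, map_zero]))
  have hnum : algebraMap (MvPolynomial (Fin n) K) (FractionRing (MvPolynomial (Fin n) K))
      (wformProd A.num) ≠ 0 :=
    fun h => (wformProd_ne_zero A.hnum) ((IsFractionRing.injective _ _) (by rw [h, map_zero]))
  have hDκ : D (algebraMap (MvPolynomial (Fin n) K) (FractionRing (MvPolynomial (Fin n) K)) (C A.κ)) = 0 := by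
    rw [hD, ← MvPolynomial.algebraMap_eq, Derivation.map_algebraMap, map_zero]
  rw [dlog, WFracPair.val_sub]
  simp only [WFracPair.val, WFracPair.den, val, map_mul]
  rw [D.leibniz_div, D.leibniz, hDκ, hD, hD]
  simp only [smul_eq_mul]
  field_simp
  ring

end WPiRatio

/-! ### Exact bloated terms `A · 𝒫 / 𝒬` and the DiDIL step -/

variable (K n) in
/-- An exact term `T = A · 𝒫 / 𝒬` of the DiDIL induction in the graded frame: `A` a `ΠΣ`-ratio,
`𝒫, 𝒬` fractions with affine-form denominators, `𝒬 ≠ 0`.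
[cite: DuttaDwivediSaxena2022, §3 proof of Thm. 3.2, the terms `(U/V)·(P/Q)` of the DiDIL induction and Claim 3.6 (full version p0030 L801–805, p0031 L836–845, p0032 L848–850)] -/
structure WExactTerm where
  /-- the `ΠΣ`-ratio factor -/
  A : WPiRatio K n
  /-- the `Σ∧Σ`-type numerator fraction -/
  P : WFracPair K n
  /-- the `Σ∧Σ`-type denominator fraction -/
  Q : WFracPair K n

namespace WExactTerm

/-- The value `A · 𝒫 / 𝒬` in `K(x)`.
[cite: DuttaDwivediSaxena2022, §3 proof of Thm. 3.2, Divide and Derive, eq. (3.2) and `T_{i,j+1} := (T_{i,j}/T̃_{k-j,j})·dlog(T_{i,j}/T̃_{k-j,j})` (full version p0030 L808–812, p0031 L815–817)] -/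
def val (T : WExactTerm K n) : FractionRing (MvPolynomial (Fin n) K) := T.A.val * T.P.val / T.Q.val

/-- Well-formedness: the denominator fraction `𝒬` has a nonzero numerator.
[cite: DuttaDwivediSaxena2022, §3 proof of Thm. 3.2, Divide and Derive, eq. (3.2) and `T_{i,j+1} := (T_{i,j}/T̃_{k-j,j})·dlog(T_{i,j}/T̃_{k-j,j})` (full version p0030 L808–812, p0031 L815–817)] -/
def WF (T : WExactTerm K n) : Prop := T.Q.p ≠ 0

/-- Nondegeneracy: the numerator fraction `𝒫` has a nonzero numerator (so `val T ≠ 0`; required of a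
divisor term).
[cite: DuttaDwivediSaxena2022, §3 proof of Thm. 3.2, Divide and Derive, eq. (3.2) and `T_{i,j+1} := (T_{i,j}/T̃_{k-j,j})·dlog(T_{i,j}/T̃_{k-j,j})` (full version p0030 L808–812, p0031 L815–817)] -/
def ND (T : WExactTerm K n) : Prop := T.P.p ≠ 0

/-- `Q_val_ne_zero` (API of the exact DiDIL objects). [cite: DuttaDwivediSaxena2022, §3 proof of Thm. 3.2, Divide and Derive, eq. (3.2) and `T_{i,j+1} := (T_{i,j}/T̃_{k-j,j})·dlog(T_{i,j}/T̃_{k-j,j})` (full version p0030 L808–812, p0031 L815–817)] -/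
theorem Q_val_ne_zero (T : WExactTerm K n) (hT : T.WF) : T.Q.val ≠ 0 :=
  div_ne_zero (fun h => hT ((IsFractionRing.injective _ _) (by rw [h, map_zero])))
    T.Q.algebraMap_den_ne_zero

/-- `P_val_ne_zero` (API of the exact DiDIL objects). [cite: DuttaDwivediSaxena2022, §3 proof of Thm. 3.2, Divide and Derive, eq. (3.2) and `T_{i,j+1} := (T_{i,j}/T̃_{k-j,j})·dlog(T_{i,j}/T̃_{k-j,j})` (full version p0030 L808–812, p0031 L815–817)] -/
theorem P_val_ne_zero (T : WExactTerm K n) (hP : T.ND) : T.P.val ≠ 0 :=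
  div_ne_zero (fun h => hP ((IsFractionRing.injective _ _) (by rw [h, map_zero])))
    T.P.algebraMap_den_ne_zero

/-- `val_ne_zero` (API of the exact DiDIL objects). [cite: DuttaDwivediSaxena2022, §3 proof of Thm. 3.2, Divide and Derive, eq. (3.2) and `T_{i,j+1} := (T_{i,j}/T̃_{k-j,j})·dlog(T_{i,j}/T̃_{k-j,j})` (full version p0030 L808–812, p0031 L815–817)] -/
theorem val_ne_zero (T : WExactTerm K n) (hT : T.WF) (hP : T.ND) : T.val ≠ 0 :=
  div_ne_zero (mul_ne_zero T.A.val_ne_zero (T.P_val_ne_zero hP)) (T.Q_val_ne_zero hT)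

/-- A well-formed term vanishes iff it is degenerate (`𝒫` has zero numerator): the divisor of a DiDIL
step may be ANY nonzero term (MEMO-t21g12 F6; print: "Wlog, assume that `min_i v_{i,j} = v_{k-j,j}`").
[cite: DuttaDwivediSaxena2022, §3 proof of Thm. 3.2, induction hypothesis (3) (full version p0030 L804–805)] -/
theorem val_eq_zero_iff (T : WExactTerm K n) (hT : T.WF) : T.val = 0 ↔ ¬ T.ND := by
  constructor
  · intro h
    by_contra hP
    exact T.val_ne_zero hT hP h
  · intro h
    have hp : T.P.p = 0 := by
      by_contra hp
      exact h hp
    simp [val, WFracPair.val, hp]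

/-- The term `κ · ∏_{a ∈ L} WForm.val a` (a shifted `ΠΣ` product: the stage-`0` input of DiDIL, with
`𝒫 = 𝒬 = 1`).
[cite: DuttaDwivediSaxena2022, §3 proof of Thm. 3.2, the terms `(U/V)·(P/Q)` of the DiDIL induction and Claim 3.6 (full version p0030 L801–805, p0031 L836–845, p0032 L848–850)] -/
def ofForms (κ : K) (hκ : κ ≠ 0) (L : List (WForm K n)) (hL : ∀ a ∈ L, a.c0 ≠ 0) :
    WExactTerm K n :=
  ⟨⟨κ, L, [], hκ, hL, by simp⟩, WFracPair.ofPoly 1, WFracPair.ofPoly 1⟩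

/-- `wf_ofForms` (API of the exact DiDIL objects). [cite: DuttaDwivediSaxena2022, §3 proof of Thm. 3.2, the terms `(U/V)·(P/Q)` of the DiDIL induction and Claim 3.6 (full version p0030 L801–805, p0031 L836–845, p0032 L848–850)] -/
theorem wf_ofForms (κ : K) (hκ : κ ≠ 0) (L : List (WForm K n))
    (hL : ∀ a ∈ L, a.c0 ≠ 0) : (ofForms κ hκ L hL).WF := by
  simp [WF, ofForms]

/-- `nd_ofForms` (API of the exact DiDIL objects). [cite: DuttaDwivediSaxena2022, §3 proof of Thm. 3.2, the terms `(U/V)·(P/Q)` of the DiDIL induction and Claim 3.6 (full version p0030 L801–805, p0031 L836–845, p0032 L848–850)] -/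
theorem nd_ofForms (κ : K) (hκ : κ ≠ 0) (L : List (WForm K n))
    (hL : ∀ a ∈ L, a.c0 ≠ 0) : (ofForms κ hκ L hL).ND := by
  simp [ND, ofForms]

/-- `val_ofForms` (API of the exact DiDIL objects). [cite: DuttaDwivediSaxena2022, §3 proof of Thm. 3.2, the terms `(U/V)·(P/Q)` of the DiDIL induction and Claim 3.6 (full version p0030 L801–805, p0031 L836–845, p0032 L848–850)] -/
theorem val_ofForms (κ : K) (hκ : κ ≠ 0) (L : List (WForm K n))
    (hL : ∀ a ∈ L, a.c0 ≠ 0) :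
    (ofForms κ hκ L hL).val =
      algebraMap (MvPolynomial (Fin n) K) (FractionRing (MvPolynomial (Fin n) K)) (C κ * wformProd L) := by
  simp [val, ofForms, WPiRatio.val, WFracPair.val_ofPoly]

/-- Scalar multiple of a term (the scalar goes into `κ`).
[cite: DuttaDwivediSaxena2022, §3 proof of Thm. 3.2, the terms `(U/V)·(P/Q)` of the DiDIL induction and Claim 3.6 (full version p0030 L801–805, p0031 L836–845, p0032 L848–850)] -/
def smul (c : K) (hc : c ≠ 0) (T : WExactTerm K n) : WExactTerm K n :=
  ⟨⟨c * T.A.κ, T.A.num, T.A.den, mul_ne_zero hc T.A.hκ, T.A.hnum, T.A.hden⟩, T.P, T.Q⟩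

/-- `val_smul` (API of the exact DiDIL objects). [cite: DuttaDwivediSaxena2022, §3 proof of Thm. 3.2, the terms `(U/V)·(P/Q)` of the DiDIL induction and Claim 3.6 (full version p0030 L801–805, p0031 L836–845, p0032 L848–850)] -/
theorem val_smul (c : K) (hc : c ≠ 0) (T : WExactTerm K n) :
    (T.smul c hc).val =
      algebraMap (MvPolynomial (Fin n) K) (FractionRing (MvPolynomial (Fin n) K)) (C c) * T.val := by
  simp only [val, smul, WPiRatio.val, map_mul]
  ring

/-- Quotient of two exact terms, `(A·𝒫/𝒬) / (A'·𝒫'/𝒬') = (A/A') · (𝒫𝒬') / (𝒬𝒫')`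
("`T_{i,j}/T̃_{k-j,j} = (U_{i,j+1}/V_{i,j+1}) · (P_{i,j} Q_{k-j,j})/(Q_{i,j} P_{k-j,j})`").
[cite: DuttaDwivediSaxena2022, §3 proof of Thm. 3.2, Divide and Derive, eq. (3.2) and `T_{i,j+1} := (T_{i,j}/T̃_{k-j,j})·dlog(T_{i,j}/T̃_{k-j,j})` (full version p0030 L808–812, p0031 L815–817)] -/
def divT (T S : WExactTerm K n) : WExactTerm K n :=
  ⟨T.A.div S.A, T.P.mul S.Q, T.Q.mul S.P⟩

/-- `wf_divT` (API of the exact DiDIL objects). [cite: DuttaDwivediSaxena2022, §3 proof of Thm. 3.2, Divide and Derive, eq. (3.2) and `T_{i,j+1} := (T_{i,j}/T̃_{k-j,j})·dlog(T_{i,j}/T̃_{k-j,j})` (full version p0030 L808–812, p0031 L815–817)] -/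
theorem wf_divT {T S : WExactTerm K n} (hT : T.WF) (hS : S.ND) : (T.divT S).WF :=
  mul_ne_zero hT hS

/-- `nd_divT` (API of the exact DiDIL objects). [cite: DuttaDwivediSaxena2022, §3 proof of Thm. 3.2, Divide and Derive, eq. (3.2) and `T_{i,j+1} := (T_{i,j}/T̃_{k-j,j})·dlog(T_{i,j}/T̃_{k-j,j})` (full version p0030 L808–812, p0031 L815–817)] -/
theorem nd_divT {T S : WExactTerm K n} (hT : T.ND) (hS : S.WF) : (T.divT S).ND :=
  mul_ne_zero hT hS

/-- `val_divT` (API of the exact DiDIL objects). [cite: DuttaDwivediSaxena2022, §3 proof of Thm. 3.2, Divide and Derive, eq. (3.2) and `T_{i,j+1} := (T_{i,j}/T̃_{k-j,j})·dlog(T_{i,j}/T̃_{k-j,j})` (full version p0030 L808–812, p0031 L815–817)] -/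
theorem val_divT (T S : WExactTerm K n) (hT : T.WF) (hS : S.WF) (hS' : S.ND) :
    (T.divT S).val = T.val / S.val := by
  have := S.Q_val_ne_zero hS
  have := S.P_val_ne_zero hS'
  have := T.Q_val_ne_zero hT
  have := S.A.val_ne_zero
  simp only [val, divT, WPiRatio.val_div, WFracPair.val_mul]
  field_simp

/-- The derivative of an exact term along a derivation `E₀` of `K[x]`, again an exact term:
`E(A·𝒫/𝒬) = A · ((EA/A)·𝒫·𝒬 + E𝒫·𝒬 − 𝒫·E𝒬) / 𝒬²`.
[cite: DuttaDwivediSaxena2022, §3 proof of Thm. 3.2, Divide and Derive, eq. (3.2) and `T_{i,j+1} := (T_{i,j}/T̃_{k-j,j})·dlog(T_{i,j}/T̃_{k-j,j})` (full version p0030 L808–812, p0031 L815–817)] -/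
def derT (E₀ : Derivation K (MvPolynomial (Fin n) K) (MvPolynomial (Fin n) K)) (T : WExactTerm K n) :
    WExactTerm K n :=
  ⟨T.A, ((T.A.dlog E₀).mul (T.P.mul T.Q)).add (((T.P.der E₀).mul T.Q).sub (T.P.mul (T.Q.der E₀))),
    T.Q.mul T.Q⟩

/-- `wf_derT` (API of the exact DiDIL objects). [cite: DuttaDwivediSaxena2022, §3 proof of Thm. 3.2, Divide and Derive, eq. (3.2) and `T_{i,j+1} := (T_{i,j}/T̃_{k-j,j})·dlog(T_{i,j}/T̃_{k-j,j})` (full version p0030 L808–812, p0031 L815–817)] -/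
theorem wf_derT (E₀ : Derivation K (MvPolynomial (Fin n) K) (MvPolynomial (Fin n) K))
    {T : WExactTerm K n} (hT : T.WF) : (T.derT E₀).WF :=
  mul_ne_zero hT hT

/-- `val_derT` (API of the exact DiDIL objects). [cite: DuttaDwivediSaxena2022, §3 proof of Thm. 3.2, Divide and Derive, eq. (3.2) and `T_{i,j+1} := (T_{i,j}/T̃_{k-j,j})·dlog(T_{i,j}/T̃_{k-j,j})` (full version p0030 L808–812, p0031 L815–817)] -/
theorem val_derT {E₀ : Derivation K (MvPolynomial (Fin n) K) (MvPolynomial (Fin n) K)}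
    {D : Derivation K (FractionRing (MvPolynomial (Fin n) K))
      (FractionRing (MvPolynomial (Fin n) K))}
    (hD : ExtendsDer K n E₀ D) (T : WExactTerm K n) (hT : T.WF) : (T.derT E₀).val = D T.val := by
  have hQ := T.Q_val_ne_zero hT
  have hA := T.A.val_ne_zero
  simp only [val, derT, WFracPair.val_add, WFracPair.val_sub, WFracPair.val_mul, WFracPair.val_der hD,
    WPiRatio.val_dlog hD]
  rw [D.leibniz_div, D.leibniz]
  simp only [smul_eq_mul]
  field_simp
  ring

/-- **The DiDIL operation on one term**: `T ↦ E(T / S)` for the divisor term `S`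
("`T_{i,j+1} := (T_{i,j}/T̃) · dlog(T_{i,j}/T̃)`", with `E = z∂_z` in the graded frame).
[cite: DuttaDwivediSaxena2022, §3 proof of Thm. 3.2, Divide and Derive, eq. (3.2) and `T_{i,j+1} := (T_{i,j}/T̃_{k-j,j})·dlog(T_{i,j}/T̃_{k-j,j})` (full version p0030 L808–812, p0031 L815–817)] -/
def didil (E₀ : Derivation K (MvPolynomial (Fin n) K) (MvPolynomial (Fin n) K))
    (T S : WExactTerm K n) : WExactTerm K n :=
  (T.divT S).derT E₀

/-- `wf_didil` (API of the exact DiDIL objects). [cite: DuttaDwivediSaxena2022, §3 proof of Thm. 3.2, Divide and Derive, eq. (3.2) and `T_{i,j+1} := (T_{i,j}/T̃_{k-j,j})·dlog(T_{i,j}/T̃_{k-j,j})` (full version p0030 L808–812, p0031 L815–817)] -/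
theorem wf_didil (E₀ : Derivation K (MvPolynomial (Fin n) K) (MvPolynomial (Fin n) K))
    {T S : WExactTerm K n} (hT : T.WF) (hS : S.ND) : (didil E₀ T S).WF :=
  wf_derT E₀ (wf_divT hT hS)

/-- `val_didil` (API of the exact DiDIL objects). [cite: DuttaDwivediSaxena2022, §3 proof of Thm. 3.2, Divide and Derive, eq. (3.2) and `T_{i,j+1} := (T_{i,j}/T̃_{k-j,j})·dlog(T_{i,j}/T̃_{k-j,j})` (full version p0030 L808–812, p0031 L815–817)] -/
theorem val_didil {E₀ : Derivation K (MvPolynomial (Fin n) K) (MvPolynomial (Fin n) K)}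
    {D : Derivation K (FractionRing (MvPolynomial (Fin n) K))
      (FractionRing (MvPolynomial (Fin n) K))}
    (hD : ExtendsDer K n E₀ D) (T S : WExactTerm K n) (hT : T.WF) (hS : S.WF) (hS' : S.ND) :
    (didil E₀ T S).val = D (T.val / S.val) := by
  rw [didil, val_derT hD _ (wf_divT hT hS'), val_divT _ _ hT hS hS']

end WExactTerm

/-- **One DiDIL step** on a family of `m + 1` exact terms with divisor index `i₀`: the `m` new terms
`E(T_i / T_{i₀})`, `i ≠ i₀`.
[cite: DuttaDwivediSaxena2022, §3 proof of Thm. 3.2, Divide and Derive, eq. (3.2) and `T_{i,j+1} := (T_{i,j}/T̃_{k-j,j})·dlog(T_{i,j}/T̃_{k-j,j})` (full version p0030 L808–812, p0031 L815–817)] -/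
def wdidilStep (E₀ : Derivation K (MvPolynomial (Fin n) K) (MvPolynomial (Fin n) K)) {m : ℕ}
    (G : Fin (m + 1) → WExactTerm K n) (i₀ : Fin (m + 1)) : Fin m → WExactTerm K n :=
  fun i => WExactTerm.didil E₀ (G (i₀.succAbove i)) (G i₀)

/-- `wf_wdidilStep` (API of the exact DiDIL objects). [cite: DuttaDwivediSaxena2022, §3 proof of Thm. 3.2, Divide and Derive, eq. (3.2) and `T_{i,j+1} := (T_{i,j}/T̃_{k-j,j})·dlog(T_{i,j}/T̃_{k-j,j})` (full version p0030 L808–812, p0031 L815–817)] -/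
theorem wf_wdidilStep (E₀ : Derivation K (MvPolynomial (Fin n) K) (MvPolynomial (Fin n) K)) {m : ℕ}
    {G : Fin (m + 1) → WExactTerm K n} (hG : ∀ i, (G i).WF) {i₀ : Fin (m + 1)} (h : (G i₀).ND)
    (i : Fin m) : (wdidilStep E₀ G i₀ i).WF :=
  WExactTerm.wf_didil E₀ (hG _) h

/-- **The DiDIL identity (3.2), exact form**: `Σ_{i ≠ i₀} E(T_i/T_{i₀}) = E((Σ_i T_i)/T_{i₀})`.
[cite: DuttaDwivediSaxena2022, §3 proof of Thm. 3.2, Divide and Derive, eq. (3.2) and `T_{i,j+1} := (T_{i,j}/T̃_{k-j,j})·dlog(T_{i,j}/T̃_{k-j,j})` (full version p0030 L808–812, p0031 L815–817)] -/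
theorem sum_val_wdidilStep {E₀ : Derivation K (MvPolynomial (Fin n) K) (MvPolynomial (Fin n) K)}
    {D : Derivation K (FractionRing (MvPolynomial (Fin n) K))
      (FractionRing (MvPolynomial (Fin n) K))}
    (hD : ExtendsDer K n E₀ D) {m : ℕ} (G : Fin (m + 1) → WExactTerm K n) (hG : ∀ i, (G i).WF)
    (i₀ : Fin (m + 1)) (h : (G i₀).ND) :
    ∑ i, (wdidilStep E₀ G i₀ i).val = D ((∑ i, (G i).val) / (G i₀).val) := by
  have h0 := (G i₀).val_ne_zero (hG i₀) h
  simp only [wdidilStep, WExactTerm.val_didil hD _ _ (hG _) (hG i₀) h]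
  rw [← map_sum, Fin.sum_univ_succAbove _ i₀, add_div, Finset.sum_div, div_self h0, map_add,
    D.leibniz_of_mul_eq_one (one_mul (1 : FractionRing (MvPolynomial (Fin n) K)))]
  simp


/-! ### Size bookkeeping: number of forms, univariate degrees `≤ δ`, degrees of numerators

Twin of B4b's `Bdd` with one more budget: every `Σ∧` form has univariate degrees `≤ δ` (an
invariant — forms are never created), so a product of `ℓ` forms has total degree `≤ δ·ℓ`; `WBdd δ B D`
books list lengths `≤ B`, numerator degrees `≤ D` and the coupling `δ·B ≤ D`. -/

/-- A product of `Σ∧` forms with univariate degrees `≤ δ` has total degree `≤ δ · (number of forms)`.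
[cite: DuttaDwivediSaxena2022, §5 proof of Thm. 5.1, "the size and degree claims remain the same" with Claim 3.6 (full version p0045 L1, p0033 L880–887)] -/
theorem totalDegree_wformProd_le {δ : ℕ} {L : List (WForm K n)} (hL : ∀ f ∈ L, f.DegLE δ) :
    (wformProd L).totalDegree ≤ δ * L.length := by
  induction L with
  | nil => simp
  | cons a L ih =>
    rw [wformProd_cons, List.length_cons, Nat.mul_succ]
    refine (totalDegree_mul _ _).trans ?_
    have h1 := WForm.totalDegree_val_le (hL a (by simp))
    have h2 := ih fun f hf => hL f (by simp [hf])
    omega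

namespace WFracPair

/-- All forms of the fraction have univariate degrees `≤ δ`. [cite: DuttaDwivediSaxena2022, §5 proof of Thm. 5.1, "the size and degree claims remain the same" with Claim 3.6 (full version p0045 L1, p0033 L880–887)] -/
def DegForms (δ : ℕ) (P : WFracPair K n) : Prop := ∀ f ∈ P.L, f.DegLE δ

/-- `totalDegree_den_le` (size API). [cite: DuttaDwivediSaxena2022, §5 proof of Thm. 5.1, "the size and degree claims remain the same" with Claim 3.6 (full version p0045 L1, p0033 L880–887)] -/
theorem totalDegree_den_le {δ : ℕ} (P : WFracPair K n) (hP : P.DegForms δ) :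
    P.den.totalDegree ≤ δ * P.L.length :=
  totalDegree_wformProd_le hP

/-- `degForms_ofPoly` (size API). [cite: DuttaDwivediSaxena2022, §5 proof of Thm. 5.1, "the size and degree claims remain the same" with Claim 3.6 (full version p0045 L1, p0033 L880–887)] -/
theorem degForms_ofPoly (δ : ℕ) (p : MvPolynomial (Fin n) K) : (ofPoly p).DegForms δ := by
  simp [DegForms]

/-- `degForms_mul` (size API). [cite: DuttaDwivediSaxena2022, §5 proof of Thm. 5.1, "the size and degree claims remain the same" with Claim 3.6 (full version p0045 L1, p0033 L880–887)] -/
theorem degForms_mul {δ : ℕ} {P Q : WFracPair K n} (hP : P.DegForms δ) (hQ : Q.DegForms δ) :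
    (P.mul Q).DegForms δ := by
  intro f hf
  rw [mul_L, List.mem_append] at hf
  exact hf.elim (hP f) (hQ f)

/-- `degForms_add` (size API). [cite: DuttaDwivediSaxena2022, §5 proof of Thm. 5.1, "the size and degree claims remain the same" with Claim 3.6 (full version p0045 L1, p0033 L880–887)] -/
theorem degForms_add {δ : ℕ} {P Q : WFracPair K n} (hP : P.DegForms δ) (hQ : Q.DegForms δ) :
    (P.add Q).DegForms δ := by
  intro f hf
  rw [add_L, List.mem_append] at hf
  exact hf.elim (hP f) (hQ f)

/-- `degForms_neg` (size API). [cite: DuttaDwivediSaxena2022, §5 proof of Thm. 5.1, "the size and degree claims remain the same" with Claim 3.6 (full version p0045 L1, p0033 L880–887)] -/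
theorem degForms_neg {δ : ℕ} {P : WFracPair K n} (hP : P.DegForms δ) : P.neg.DegForms δ := hP

/-- `degForms_sub` (size API). [cite: DuttaDwivediSaxena2022, §5 proof of Thm. 5.1, "the size and degree claims remain the same" with Claim 3.6 (full version p0045 L1, p0033 L880–887)] -/
theorem degForms_sub {δ : ℕ} {P Q : WFracPair K n} (hP : P.DegForms δ) (hQ : Q.DegForms δ) :
    (P.sub Q).DegForms δ :=
  degForms_add hP (degForms_neg hQ)

/-- `degForms_smul` (size API). [cite: DuttaDwivediSaxena2022, §5 proof of Thm. 5.1, "the size and degree claims remain the same" with Claim 3.6 (full version p0045 L1, p0033 L880–887)] -/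
theorem degForms_smul {δ : ℕ} (c : K) {P : WFracPair K n} (hP : P.DegForms δ) :
    (P.smul c).DegForms δ := hP

/-- `degForms_der` (size API). [cite: DuttaDwivediSaxena2022, §5 proof of Thm. 5.1, "the size and degree claims remain the same" with Claim 3.6 (full version p0045 L1, p0033 L880–887)] -/
theorem degForms_der {δ : ℕ} (E₀ : Derivation K (MvPolynomial (Fin n) K) (MvPolynomial (Fin n) K))
    {P : WFracPair K n} (hP : P.DegForms δ) : (P.der E₀).DegForms δ := by
  intro f hf
  rw [der_L, List.mem_append] at hf
  exact hf.elim (hP f) (hP f)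

/-- `length_mul` (size API). [cite: DuttaDwivediSaxena2022, §5 proof of Thm. 5.1, "the size and degree claims remain the same" with Claim 3.6 (full version p0045 L1, p0033 L880–887)] -/
theorem length_mul (P Q : WFracPair K n) : (P.mul Q).L.length = P.L.length + Q.L.length := by
  simp

/-- `totalDegree_mul_le` (size API). [cite: DuttaDwivediSaxena2022, §5 proof of Thm. 5.1, "the size and degree claims remain the same" with Claim 3.6 (full version p0045 L1, p0033 L880–887)] -/
theorem totalDegree_mul_le (P Q : WFracPair K n) :
    (P.mul Q).p.totalDegree ≤ P.p.totalDegree + Q.p.totalDegree :=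
  totalDegree_mul _ _

/-- `totalDegree_den_mul_le` (size API). [cite: DuttaDwivediSaxena2022, §5 proof of Thm. 5.1, "the size and degree claims remain the same" with Claim 3.6 (full version p0045 L1, p0033 L880–887)] -/
theorem totalDegree_den_mul_le (P Q : WFracPair K n) :
    (P.mul Q).den.totalDegree ≤ P.den.totalDegree + Q.den.totalDegree := by
  rw [den_mul]; exact totalDegree_mul _ _

/-- `length_add` (size API). [cite: DuttaDwivediSaxena2022, §5 proof of Thm. 5.1, "the size and degree claims remain the same" with Claim 3.6 (full version p0045 L1, p0033 L880–887)] -/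
theorem length_add (P Q : WFracPair K n) : (P.add Q).L.length = P.L.length + Q.L.length := by
  simp

/-- `totalDegree_add_le` (size API): degrees of `p·den' + q·den`. [cite: DuttaDwivediSaxena2022, §5 proof of Thm. 5.1, "the size and degree claims remain the same" with Claim 3.6 (full version p0045 L1, p0033 L880–887)] -/
theorem totalDegree_add_le (P Q : WFracPair K n) :
    (P.add Q).p.totalDegree ≤
      max (P.p.totalDegree + Q.den.totalDegree) (Q.p.totalDegree + P.den.totalDegree) := by
  rw [add_p]
  refine (totalDegree_add _ _).trans (max_le_max ?_ ?_)
  · exact totalDegree_mul _ _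
  · exact totalDegree_mul _ _

/-- `totalDegree_den_add_le` (size API). [cite: DuttaDwivediSaxena2022, §5 proof of Thm. 5.1, "the size and degree claims remain the same" with Claim 3.6 (full version p0045 L1, p0033 L880–887)] -/
theorem totalDegree_den_add_le (P Q : WFracPair K n) :
    (P.add Q).den.totalDegree ≤ P.den.totalDegree + Q.den.totalDegree := by
  rw [den_add]; exact totalDegree_mul _ _

/-- `length_neg` (size API). [cite: DuttaDwivediSaxena2022, §5 proof of Thm. 5.1, "the size and degree claims remain the same" with Claim 3.6 (full version p0045 L1, p0033 L880–887)] -/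
theorem length_neg (P : WFracPair K n) : P.neg.L.length = P.L.length := rfl

/-- `totalDegree_neg` (size API). [cite: DuttaDwivediSaxena2022, §5 proof of Thm. 5.1, "the size and degree claims remain the same" with Claim 3.6 (full version p0045 L1, p0033 L880–887)] -/
theorem totalDegree_neg (P : WFracPair K n) : P.neg.p.totalDegree = P.p.totalDegree := by
  rw [neg_p, MvPolynomial.totalDegree_neg]

/-- `length_sub` (size API). [cite: DuttaDwivediSaxena2022, §5 proof of Thm. 5.1, "the size and degree claims remain the same" with Claim 3.6 (full version p0045 L1, p0033 L880–887)] -/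
theorem length_sub (P Q : WFracPair K n) : (P.sub Q).L.length = P.L.length + Q.L.length := by
  simp

/-- `totalDegree_sub_le` (size API). [cite: DuttaDwivediSaxena2022, §5 proof of Thm. 5.1, "the size and degree claims remain the same" with Claim 3.6 (full version p0045 L1, p0033 L880–887)] -/
theorem totalDegree_sub_le (P Q : WFracPair K n) :
    (P.sub Q).p.totalDegree ≤
      max (P.p.totalDegree + Q.den.totalDegree) (Q.p.totalDegree + P.den.totalDegree) := by
  have h := totalDegree_add_le P Q.neg
  rwa [totalDegree_neg, den_neg] at h

/-- `totalDegree_den_sub_le` (size API). [cite: DuttaDwivediSaxena2022, §5 proof of Thm. 5.1, "the size and degree claims remain the same" with Claim 3.6 (full version p0045 L1, p0033 L880–887)] -/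
theorem totalDegree_den_sub_le (P Q : WFracPair K n) :
    (P.sub Q).den.totalDegree ≤ P.den.totalDegree + Q.den.totalDegree := by
  have h := totalDegree_den_add_le P Q.neg
  rwa [den_neg] at h

/-- `length_smul` (size API). [cite: DuttaDwivediSaxena2022, §5 proof of Thm. 5.1, "the size and degree claims remain the same" with Claim 3.6 (full version p0045 L1, p0033 L880–887)] -/
theorem length_smul (c : K) (P : WFracPair K n) : (P.smul c).L.length = P.L.length := rfl

/-- `totalDegree_smul_le` (size API). [cite: DuttaDwivediSaxena2022, §5 proof of Thm. 5.1, "the size and degree claims remain the same" with Claim 3.6 (full version p0045 L1, p0033 L880–887)] -/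
theorem totalDegree_smul_le (c : K) (P : WFracPair K n) :
    (P.smul c).p.totalDegree ≤ P.p.totalDegree :=
  (totalDegree_mul _ _).trans (by rw [totalDegree_C, zero_add])

/-- `length_der` (size API). [cite: DuttaDwivediSaxena2022, §5 proof of Thm. 5.1, "the size and degree claims remain the same" with Claim 3.6 (full version p0045 L1, p0033 L880–887)] -/
theorem length_der (E₀ : Derivation K (MvPolynomial (Fin n) K) (MvPolynomial (Fin n) K))
    (P : WFracPair K n) : (P.der E₀).L.length = 2 * P.L.length := by
  simp [two_mul]

/-- `totalDegree_der_le` (size API). [cite: DuttaDwivediSaxena2022, §5 proof of Thm. 5.1, "the size and degree claims remain the same" with Claim 3.6 (full version p0045 L1, p0033 L880–887)] -/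
theorem totalDegree_der_le {E₀ : Derivation K (MvPolynomial (Fin n) K) (MvPolynomial (Fin n) K)}
    (hE : DegLE E₀) (P : WFracPair K n) :
    (P.der E₀).p.totalDegree ≤ P.p.totalDegree + P.den.totalDegree := by
  rw [der_p]
  refine (totalDegree_sub _ _).trans (max_le ?_ ?_)
  · exact (totalDegree_mul _ _).trans (Nat.add_le_add_right (hE _) _)
  · exact (totalDegree_mul _ _).trans (Nat.add_le_add_left (hE _) _)

/-- `totalDegree_den_der_le` (size API). [cite: DuttaDwivediSaxena2022, §5 proof of Thm. 5.1, "the size and degree claims remain the same" with Claim 3.6 (full version p0045 L1, p0033 L880–887)] -/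
theorem totalDegree_den_der_le (E₀ : Derivation K (MvPolynomial (Fin n) K) (MvPolynomial (Fin n) K))
    (P : WFracPair K n) : (P.der E₀).den.totalDegree ≤ P.den.totalDegree + P.den.totalDegree := by
  rw [den_der]; exact totalDegree_mul _ _

end WFracPair

namespace WPiRatio

/-- All forms of the `ΠΣ∧`-ratio have univariate degrees `≤ δ`. [cite: DuttaDwivediSaxena2022, §5 proof of Thm. 5.1, "the size and degree claims remain the same" with Claim 3.6 (full version p0045 L1, p0033 L880–887)] -/
def DegForms (δ : ℕ) (A : WPiRatio K n) : Prop := (∀ f ∈ A.num, f.DegLE δ) ∧ (∀ f ∈ A.den, f.DegLE δ)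

/-- `length_num_div` (size API). [cite: DuttaDwivediSaxena2022, §5 proof of Thm. 5.1, "the size and degree claims remain the same" with Claim 3.6 (full version p0045 L1, p0033 L880–887)] -/
theorem length_num_div (A B : WPiRatio K n) : (A.div B).num.length = A.num.length + B.den.length := by
  simp [div]

/-- `length_den_div` (size API). [cite: DuttaDwivediSaxena2022, §5 proof of Thm. 5.1, "the size and degree claims remain the same" with Claim 3.6 (full version p0045 L1, p0033 L880–887)] -/
theorem length_den_div (A B : WPiRatio K n) : (A.div B).den.length = A.den.length + B.num.length := by
  simp [div]

/-- `degForms_div` (size API). [cite: DuttaDwivediSaxena2022, §5 proof of Thm. 5.1, "the size and degree claims remain the same" with Claim 3.6 (full version p0045 L1, p0033 L880–887)] -/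
theorem degForms_div {δ : ℕ} {A B : WPiRatio K n} (hA : A.DegForms δ) (hB : B.DegForms δ) :
    (A.div B).DegForms δ := by
  refine ⟨fun f hf => ?_, fun f hf => ?_⟩
  · simp only [div, List.mem_append] at hf
    exact hf.elim (hA.1 f) (hB.2 f)
  · simp only [div, List.mem_append] at hf
    exact hf.elim (hA.2 f) (hB.1 f)

/-- `length_dlog` (size API). [cite: DuttaDwivediSaxena2022, §5 proof of Thm. 5.1, "the size and degree claims remain the same" with Claim 3.6 (full version p0045 L1, p0033 L880–887)] -/
theorem length_dlog (E₀ : Derivation K (MvPolynomial (Fin n) K) (MvPolynomial (Fin n) K))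
    (A : WPiRatio K n) : (A.dlog E₀).L.length = A.num.length + A.den.length := by
  simp

/-- `degForms_dlog` (size API). [cite: DuttaDwivediSaxena2022, §5 proof of Thm. 5.1, "the size and degree claims remain the same" with Claim 3.6 (full version p0045 L1, p0033 L880–887)] -/
theorem degForms_dlog {δ : ℕ} (E₀ : Derivation K (MvPolynomial (Fin n) K) (MvPolynomial (Fin n) K))
    {A : WPiRatio K n} (hA : A.DegForms δ) : (A.dlog E₀).DegForms δ := by
  intro f hf
  rw [dlog_L, List.mem_append] at hf
  exact hf.elim (hA.1 f) (hA.2 f)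

/-- `totalDegree_dlog_le` (size API): `deg (E Π · Π' − Π · E Π') ≤ δ(|num| + |den|)`. [cite: DuttaDwivediSaxena2022, §5 proof of Thm. 5.1, "the size and degree claims remain the same" with Claim 3.6 (full version p0045 L1, p0033 L880–887)] -/
theorem totalDegree_dlog_le {E₀ : Derivation K (MvPolynomial (Fin n) K) (MvPolynomial (Fin n) K)}
    (hE : DegLE E₀) {δ : ℕ} (A : WPiRatio K n) (hA : A.DegForms δ) :
    (A.dlog E₀).p.totalDegree ≤ δ * A.num.length + δ * A.den.length := by
  have h1 := totalDegree_wformProd_le hA.1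
  have h2 := totalDegree_wformProd_le hA.2
  refine (WFracPair.totalDegree_sub_le _ _).trans (max_le ?_ ?_)
  · change (E₀ (wformProd A.num)).totalDegree + (wformProd A.den).totalDegree ≤ _
    have h3 := (hE (wformProd A.num)).trans h1
    omega
  · change (E₀ (wformProd A.den)).totalDegree + (wformProd A.num).totalDegree ≤ _
    have h3 := (hE (wformProd A.den)).trans h2
    omega

/-- `totalDegree_den_dlog_le` (size API). [cite: DuttaDwivediSaxena2022, §5 proof of Thm. 5.1, "the size and degree claims remain the same" with Claim 3.6 (full version p0045 L1, p0033 L880–887)] -/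
theorem totalDegree_den_dlog_le (E₀ : Derivation K (MvPolynomial (Fin n) K) (MvPolynomial (Fin n) K))
    {δ : ℕ} (A : WPiRatio K n) (hA : A.DegForms δ) :
    (A.dlog E₀).den.totalDegree ≤ δ * A.num.length + δ * A.den.length := by
  have h1 := totalDegree_wformProd_le hA.1
  have h2 := totalDegree_wformProd_le hA.2
  change (wformProd (A.num ++ A.den)).totalDegree ≤ _
  rw [wformProd_append]
  exact (totalDegree_mul _ _).trans (Nat.add_le_add h1 h2)

end WPiRatio

namespace WExactTerm

/-- All forms of the term have univariate degrees `≤ δ` (invariant of the iteration). [cite: DuttaDwivediSaxena2022, §5 proof of Thm. 5.1, "the size and degree claims remain the same" with Claim 3.6 (full version p0045 L1, p0033 L880–887)] -/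
def DegForms (δ : ℕ) (T : WExactTerm K n) : Prop := T.A.DegForms δ ∧ T.P.DegForms δ ∧ T.Q.DegForms δ

/-- `degForms_ofForms` (size API). [cite: DuttaDwivediSaxena2022, §5 proof of Thm. 5.1, "the size and degree claims remain the same" with Claim 3.6 (full version p0045 L1, p0033 L880–887)] -/
theorem degForms_ofForms {δ : ℕ} (κ : K) (hκ : κ ≠ 0) (L : List (WForm K n))
    (hL : ∀ a ∈ L, a.c0 ≠ 0) (hd : ∀ f ∈ L, f.DegLE δ) : (ofForms κ hκ L hL).DegForms δ := by
  refine ⟨⟨hd, ?_⟩, ?_, ?_⟩ <;> simp [ofForms, WFracPair.DegForms, WFracPair.ofPoly]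

/-- `degForms_smul` (size API). [cite: DuttaDwivediSaxena2022, §5 proof of Thm. 5.1, "the size and degree claims remain the same" with Claim 3.6 (full version p0045 L1, p0033 L880–887)] -/
theorem degForms_smul {δ : ℕ} (c : K) (hc : c ≠ 0) {T : WExactTerm K n} (h : T.DegForms δ) :
    (T.smul c hc).DegForms δ := h

/-- `degForms_divT` (size API). [cite: DuttaDwivediSaxena2022, §5 proof of Thm. 5.1, "the size and degree claims remain the same" with Claim 3.6 (full version p0045 L1, p0033 L880–887)] -/
theorem degForms_divT {δ : ℕ} {T S : WExactTerm K n} (hT : T.DegForms δ) (hS : S.DegForms δ) :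
    (T.divT S).DegForms δ :=
  ⟨WPiRatio.degForms_div hT.1 hS.1, WFracPair.degForms_mul hT.2.1 hS.2.2,
    WFracPair.degForms_mul hT.2.2 hS.2.1⟩

/-- `degForms_derT` (size API). [cite: DuttaDwivediSaxena2022, §5 proof of Thm. 5.1, "the size and degree claims remain the same" with Claim 3.6 (full version p0045 L1, p0033 L880–887)] -/
theorem degForms_derT {δ : ℕ} (E₀ : Derivation K (MvPolynomial (Fin n) K) (MvPolynomial (Fin n) K))
    {T : WExactTerm K n} (hT : T.DegForms δ) : (T.derT E₀).DegForms δ := by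
  obtain ⟨hA, hP, hQ⟩ := hT
  refine ⟨hA, ?_, WFracPair.degForms_mul hQ hQ⟩
  exact WFracPair.degForms_add (WFracPair.degForms_mul (WPiRatio.degForms_dlog E₀ hA)
    (WFracPair.degForms_mul hP hQ)) (WFracPair.degForms_sub
      (WFracPair.degForms_mul (WFracPair.degForms_der E₀ hP) hQ)
      (WFracPair.degForms_mul hP (WFracPair.degForms_der E₀ hQ)))

/-- `degForms_didil` (size API). [cite: DuttaDwivediSaxena2022, §5 proof of Thm. 5.1, "the size and degree claims remain the same" with Claim 3.6 (full version p0045 L1, p0033 L880–887)] -/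
theorem degForms_didil {δ : ℕ} (E₀ : Derivation K (MvPolynomial (Fin n) K) (MvPolynomial (Fin n) K))
    {T S : WExactTerm K n} (hT : T.DegForms δ) (hS : S.DegForms δ) : (didil E₀ T S).DegForms δ :=
  degForms_derT E₀ (degForms_divT hT hS)

/-- **Size of an exact term**, `Σ∧` version: list lengths `≤ B`, numerator degrees `≤ D`, with the
coupling `δ · B ≤ D` (so form products of length `≤ B` have degree `≤ D`). [cite: DuttaDwivediSaxena2022, §5 proof of Thm. 5.1, "the size and degree claims remain the same" with Claim 3.6 (full version p0045 L1, p0033 L880–887)] -/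
def WBdd (δ B D : ℕ) (T : WExactTerm K n) : Prop :=
  T.A.num.length ≤ B ∧ T.A.den.length ≤ B ∧ T.P.p.totalDegree ≤ D ∧ T.P.L.length ≤ B ∧
    T.Q.p.totalDegree ≤ D ∧ T.Q.L.length ≤ B ∧ δ * B ≤ D

/-- `WBdd.mono` (size API). [cite: DuttaDwivediSaxena2022, §5 proof of Thm. 5.1, "the size and degree claims remain the same" with Claim 3.6 (full version p0045 L1, p0033 L880–887)] -/
theorem WBdd.mono {δ B B' D D' : ℕ} {T : WExactTerm K n} (h : T.WBdd δ B D) (hB : B ≤ B')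
    (hD : D ≤ D') (hc : δ * B' ≤ D') : T.WBdd δ B' D' := by
  obtain ⟨h1, h2, h3, h4, h5, h6, -⟩ := h
  exact ⟨h1.trans hB, h2.trans hB, h3.trans hD, h4.trans hB, h5.trans hD, h6.trans hB, hc⟩

/-- `wbdd_ofForms` (size API). [cite: DuttaDwivediSaxena2022, §5 proof of Thm. 5.1, "the size and degree claims remain the same" with Claim 3.6 (full version p0045 L1, p0033 L880–887)] -/
theorem wbdd_ofForms (δ : ℕ) (κ : K) (hκ : κ ≠ 0) (L : List (WForm K n))
    (hL : ∀ a ∈ L, a.c0 ≠ 0) : (ofForms κ hκ L hL).WBdd δ L.length (δ * L.length) := by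
  refine ⟨le_rfl, ?_, ?_, ?_, ?_, ?_, le_rfl⟩ <;> simp [ofForms, WFracPair.ofPoly]

/-- `wbdd_smul` (size API). [cite: DuttaDwivediSaxena2022, §5 proof of Thm. 5.1, "the size and degree claims remain the same" with Claim 3.6 (full version p0045 L1, p0033 L880–887)] -/
theorem wbdd_smul {δ B D : ℕ} (c : K) (hc : c ≠ 0) {T : WExactTerm K n} (h : T.WBdd δ B D) :
    (T.smul c hc).WBdd δ B D := h

/-- Degrees of the basic denominators under `WBdd` + `DegForms`. [cite: DuttaDwivediSaxena2022, §5 proof of Thm. 5.1, "the size and degree claims remain the same" with Claim 3.6 (full version p0045 L1, p0033 L880–887)] -/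
theorem den_le_of_wbdd {δ B D : ℕ} {T : WExactTerm K n} (h : T.WBdd δ B D) (hd : T.DegForms δ) :
    T.P.den.totalDegree ≤ D ∧ T.Q.den.totalDegree ≤ D ∧
      (wformProd T.A.num).totalDegree ≤ D ∧ (wformProd T.A.den).totalDegree ≤ D := by
  obtain ⟨h1, h2, -, h4, -, h6, h7⟩ := h
  obtain ⟨hA, hP, hQ⟩ := hd
  refine ⟨(T.P.totalDegree_den_le hP).trans ((Nat.mul_le_mul_left δ h4).trans h7),
    (T.Q.totalDegree_den_le hQ).trans ((Nat.mul_le_mul_left δ h6).trans h7),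
    (totalDegree_wformProd_le hA.1).trans ((Nat.mul_le_mul_left δ h1).trans h7),
    (totalDegree_wformProd_le hA.2).trans ((Nat.mul_le_mul_left δ h2).trans h7)⟩

/-- `wbdd_divT` (size API): `(2B, 2D)`. [cite: DuttaDwivediSaxena2022, §5 proof of Thm. 5.1, "the size and degree claims remain the same" with Claim 3.6 (full version p0045 L1, p0033 L880–887)] -/
theorem wbdd_divT {δ B D : ℕ} {T S : WExactTerm K n} (hT : T.WBdd δ B D) (hS : S.WBdd δ B D) :
    (T.divT S).WBdd δ (2 * B) (2 * D) := by
  obtain ⟨h1, h2, h3, h4, h5, h6, h7⟩ := hT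
  obtain ⟨g1, g2, g3, g4, g5, g6, -⟩ := hS
  refine ⟨?_, ?_, ?_, ?_, ?_, ?_, ?_⟩
  · rw [divT, WPiRatio.length_num_div]; omega
  · rw [divT, WPiRatio.length_den_div]; omega
  · exact (WFracPair.totalDegree_mul_le _ _).trans (by omega)
  · simp only [divT, WFracPair.length_mul]; omega
  · exact (WFracPair.totalDegree_mul_le _ _).trans (by omega)
  · simp only [divT, WFracPair.length_mul]; omega
  · rw [Nat.mul_left_comm]; omega

/-- `wbdd_derT` (size API): `(10B, 10D)` for a degree-preserving derivation. [cite: DuttaDwivediSaxena2022, §5 proof of Thm. 5.1, "the size and degree claims remain the same" with Claim 3.6 (full version p0045 L1, p0033 L880–887)] -/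
theorem wbdd_derT {E₀ : Derivation K (MvPolynomial (Fin n) K) (MvPolynomial (Fin n) K)}
    (hE : DegLE E₀) {δ B D : ℕ} {T : WExactTerm K n} (hT : T.WBdd δ B D) (hd : T.DegForms δ) :
    (T.derT E₀).WBdd δ (10 * B) (10 * D) := by
  obtain ⟨dP, dQ, dnum, dden⟩ := den_le_of_wbdd hT hd
  obtain ⟨h1, h2, h3, h4, h5, h6, h7⟩ := hT
  obtain ⟨hA, hP, hQ⟩ := hd
  have hdl : (T.A.dlog E₀).p.totalDegree ≤ 2 * D := by
    have h := WPiRatio.totalDegree_dlog_le hE T.A hA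
    have e1 := Nat.mul_le_mul_left δ h1
    have e2 := Nat.mul_le_mul_left δ h2
    omega
  have hdlden : (T.A.dlog E₀).den.totalDegree ≤ 2 * D := by
    have h := WPiRatio.totalDegree_den_dlog_le E₀ T.A hA
    have e1 := Nat.mul_le_mul_left δ h1
    have e2 := Nat.mul_le_mul_left δ h2
    omega
  have hdlL := WPiRatio.length_dlog E₀ T.A
  have hdP := WFracPair.totalDegree_der_le hE T.P
  have hdQ := WFracPair.totalDegree_der_le hE T.Q
  have hdPden := WFracPair.totalDegree_den_der_le E₀ T.P
  have hdQden := WFracPair.totalDegree_den_der_le E₀ T.Q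
  have hdPL := WFracPair.length_der E₀ T.P
  have hdQL := WFracPair.length_der E₀ T.Q
  refine ⟨by simp only [derT]; omega, by simp only [derT]; omega, ?_, ?_, ?_, ?_, ?_⟩
  · -- numerator of `𝒫'`
    simp only [derT]
    refine (WFracPair.totalDegree_add_le _ _).trans (max_le ?_ ?_)
    · have hm := WFracPair.totalDegree_mul_le (T.A.dlog E₀) (T.P.mul T.Q)
      have hm2 := WFracPair.totalDegree_mul_le T.P T.Q
      have hdd := WFracPair.totalDegree_den_sub_le ((T.P.der E₀).mul T.Q) (T.P.mul (T.Q.der E₀))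
      have hdd1 := WFracPair.totalDegree_den_mul_le (T.P.der E₀) T.Q
      have hdd2 := WFracPair.totalDegree_den_mul_le T.P (T.Q.der E₀)
      simp only [WFracPair.mul_p] at hm hm2 ⊢
      omega
    · have hs := WFracPair.totalDegree_sub_le ((T.P.der E₀).mul T.Q) (T.P.mul (T.Q.der E₀))
      have hm1 := WFracPair.totalDegree_mul_le (T.P.der E₀) T.Q
      have hm2 := WFracPair.totalDegree_mul_le T.P (T.Q.der E₀)
      have hdd1 := WFracPair.totalDegree_den_mul_le (T.P.der E₀) T.Q
      have hdd2 := WFracPair.totalDegree_den_mul_le T.P (T.Q.der E₀)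
      have hdd3 := WFracPair.totalDegree_den_mul_le (T.A.dlog E₀) (T.P.mul T.Q)
      have hdd4 := WFracPair.totalDegree_den_mul_le T.P T.Q
      omega
  · simp only [derT, WFracPair.length_add, WFracPair.length_mul, WFracPair.length_sub, hdlL, hdPL,
      hdQL]
    omega
  · simp only [derT]
    exact (WFracPair.totalDegree_mul_le _ _).trans (by omega)
  · simp only [derT, WFracPair.length_mul]
    omega
  · rw [Nat.mul_left_comm]; omega

/-- `wbdd_didil` (size API): `(20B, 20D)`. [cite: DuttaDwivediSaxena2022, §5 proof of Thm. 5.1, "the size and degree claims remain the same" with Claim 3.6 (full version p0045 L1, p0033 L880–887)] -/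
theorem wbdd_didil {E₀ : Derivation K (MvPolynomial (Fin n) K) (MvPolynomial (Fin n) K)}
    (hE : DegLE E₀) {δ B D : ℕ} {T S : WExactTerm K n} (hT : T.WBdd δ B D) (hS : S.WBdd δ B D)
    (hTd : T.DegForms δ) (hSd : S.DegForms δ) :
    (didil E₀ T S).WBdd δ (20 * B) (20 * D) := by
  have h := wbdd_derT hE (wbdd_divT hT hS) (degForms_divT hTd hSd)
  rw [← mul_assoc, ← mul_assoc] at h
  exact h

end WExactTerm

/-- `degForms_wdidilStep` (size API). [cite: DuttaDwivediSaxena2022, §5 proof of Thm. 5.1, "the size and degree claims remain the same" with Claim 3.6 (full version p0045 L1, p0033 L880–887)] -/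
theorem degForms_wdidilStep {δ : ℕ}
    (E₀ : Derivation K (MvPolynomial (Fin n) K) (MvPolynomial (Fin n) K)) {m : ℕ}
    {G : Fin (m + 1) → WExactTerm K n} (hG : ∀ i, (G i).DegForms δ) (i₀ : Fin (m + 1)) (i : Fin m) :
    (wdidilStep E₀ G i₀ i).DegForms δ :=
  WExactTerm.degForms_didil E₀ (hG _) (hG _)

/-- `wbdd_wdidilStep` (size API). [cite: DuttaDwivediSaxena2022, §5 proof of Thm. 5.1, "the size and degree claims remain the same" with Claim 3.6 (full version p0045 L1, p0033 L880–887)] -/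
theorem wbdd_wdidilStep {E₀ : Derivation K (MvPolynomial (Fin n) K) (MvPolynomial (Fin n) K)}
    (hE : DegLE E₀) {δ B D m : ℕ} {G : Fin (m + 1) → WExactTerm K n} (hG : ∀ i, (G i).WBdd δ B D)
    (hd : ∀ i, (G i).DegForms δ) (i₀ : Fin (m + 1)) (i : Fin m) :
    (wdidilStep E₀ G i₀ i).WBdd δ (20 * B) (20 * D) :=
  WExactTerm.wbdd_didil hE (hG _) (hG _) (hd _) (hd _)

/-! ### Constant terms of form products; explicit numerator / denominator of a term -/

/-- `coeff_zero_wformProd` (API of the exact DiDIL objects). [cite: DuttaDwivediSaxena2022, Def. 3.1 and §2.3 (`ΠΣ` = products of affine forms, `Σ∧Σ`), full version p0026 L702–707, p0020 L537–540] -/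
theorem coeff_zero_wformProd (L : List (WForm K n)) :
    coeff 0 (wformProd L) = (L.map fun a => a.c0).prod := by
  induction L with
  | nil => simp
  | cons a L ih =>
    rw [wformProd_cons, List.map_cons, List.prod_cons, ← ih, ← WForm.coeff_zero_val a]
    simp only [← constantCoeff_eq, map_mul]

/-- `coeff_zero_wformProd_ne_zero` (API of the exact DiDIL objects). [cite: DuttaDwivediSaxena2022, Def. 3.1 and §2.3 (`ΠΣ` = products of affine forms, `Σ∧Σ`), full version p0026 L702–707, p0020 L537–540] -/
theorem coeff_zero_wformProd_ne_zero {L : List (WForm K n)} (hL : ∀ a ∈ L, a.c0 ≠ 0) :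
    coeff 0 (wformProd L) ≠ 0 := by
  rw [coeff_zero_wformProd]
  exact List.prod_ne_zero fun h => by
    obtain ⟨a, ha, ha0⟩ := List.mem_map.1 h
    exact hL a ha ha0

namespace WFracPair

/-- `coeff_zero_den_ne_zero` (API of the exact DiDIL objects). [cite: DuttaDwivediSaxena2022, §3 proof of Thm. 3.2, the terms `(U/V)·(P/Q)` of the DiDIL induction and Claim 3.6 (full version p0030 L801–805, p0031 L836–845, p0032 L848–850)] -/
theorem coeff_zero_den_ne_zero (P : WFracPair K n) : coeff 0 P.den ≠ 0 :=
  coeff_zero_wformProd_ne_zero P.hL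

end WFracPair

namespace WExactTerm

/-- The explicit numerator polynomial `κ · ∏num · p · ∏L_𝒬` of `T = A·𝒫/𝒬`.
[cite: DuttaDwivediSaxena2022, §3 proof of Thm. 3.2, the terms `(U/V)·(P/Q)` of the DiDIL induction and Claim 3.6 (full version p0030 L801–805, p0031 L836–845, p0032 L848–850)] -/
def numPoly (T : WExactTerm K n) : MvPolynomial (Fin n) K :=
  C T.A.κ * wformProd T.A.num * T.P.p * T.Q.den

/-- The explicit denominator polynomial `∏den · q · ∏L_𝒫` of `T = A·𝒫/𝒬`.
[cite: DuttaDwivediSaxena2022, §3 proof of Thm. 3.2, the terms `(U/V)·(P/Q)` of the DiDIL induction and Claim 3.6 (full version p0030 L801–805, p0031 L836–845, p0032 L848–850)] -/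
def denPoly (T : WExactTerm K n) : MvPolynomial (Fin n) K :=
  wformProd T.A.den * T.Q.p * T.P.den

/-- `denPoly_ne_zero` (API of the exact DiDIL objects). [cite: DuttaDwivediSaxena2022, §3 proof of Thm. 3.2, the terms `(U/V)·(P/Q)` of the DiDIL induction and Claim 3.6 (full version p0030 L801–805, p0031 L836–845, p0032 L848–850)] -/
theorem denPoly_ne_zero (T : WExactTerm K n) (hT : T.WF) : T.denPoly ≠ 0 :=
  mul_ne_zero (mul_ne_zero (wformProd_ne_zero T.A.hden) hT) T.P.den_ne_zero

/-- `numPoly_ne_zero` (API of the exact DiDIL objects). [cite: DuttaDwivediSaxena2022, §3 proof of Thm. 3.2, the terms `(U/V)·(P/Q)` of the DiDIL induction and Claim 3.6 (full version p0030 L801–805, p0031 L836–845, p0032 L848–850)] -/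
theorem numPoly_ne_zero (T : WExactTerm K n) (hT : T.ND) : T.numPoly ≠ 0 :=
  mul_ne_zero (mul_ne_zero (mul_ne_zero (C_eq_zero.not.2 T.A.hκ) (wformProd_ne_zero T.A.hnum)) hT)
    T.Q.den_ne_zero

/-- `val_eq_numPoly_div_denPoly` (API of the exact DiDIL objects). [cite: DuttaDwivediSaxena2022, §3 proof of Thm. 3.2, the terms `(U/V)·(P/Q)` of the DiDIL induction and Claim 3.6 (full version p0030 L801–805, p0031 L836–845, p0032 L848–850)] -/
theorem val_eq_numPoly_div_denPoly (T : WExactTerm K n) (hT : T.WF) :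
    T.val = algebraMap (MvPolynomial (Fin n) K) (FractionRing (MvPolynomial (Fin n) K)) T.numPoly /
      algebraMap (MvPolynomial (Fin n) K) (FractionRing (MvPolynomial (Fin n) K)) T.denPoly := by
  have h1 := T.A.algebraMap_den_ne_zero
  have h2 := T.P.algebraMap_den_ne_zero
  have h3 := T.Q.algebraMap_den_ne_zero
  have h4 : algebraMap (MvPolynomial (Fin n) K) (FractionRing (MvPolynomial (Fin n) K)) T.Q.p ≠ 0 :=
    fun h => hT ((IsFractionRing.injective _ _) (by rw [h, map_zero]))
  simp only [val, numPoly, denPoly, WPiRatio.val, WFracPair.val, map_mul]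
  field_simp

/-- The cleared identity `val T · denPoly = numPoly` (no well-formedness needed when stated as
`numPoly = val · denPoly` would fail; we state the division-free consequence under `WF`).
[cite: DuttaDwivediSaxena2022, §3 proof of Thm. 3.2, the terms `(U/V)·(P/Q)` of the DiDIL induction and Claim 3.6 (full version p0030 L801–805, p0031 L836–845, p0032 L848–850)] -/
theorem val_mul_denPoly (T : WExactTerm K n) (hT : T.WF) :
    T.val * algebraMap (MvPolynomial (Fin n) K) (FractionRing (MvPolynomial (Fin n) K)) T.denPoly =
      algebraMap (MvPolynomial (Fin n) K) (FractionRing (MvPolynomial (Fin n) K)) T.numPoly := by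
  have h : algebraMap (MvPolynomial (Fin n) K) (FractionRing (MvPolynomial (Fin n) K)) T.denPoly ≠ 0 :=
    fun h => (T.denPoly_ne_zero hT) ((IsFractionRing.injective _ _) (by rw [h, map_zero]))
  rw [T.val_eq_numPoly_div_denPoly hT, div_mul_cancel₀ _ h]

end WExactTerm


/-! ### Convolution sums stay in `Σ∧Σ∧` (budget arithmetic for graded components of products) -/

/-- If `u_a ∈ Σ∧Σ∧(t₁, e₁, δ)` and `v_b ∈ Σ∧Σ∧(t₂, e₂, δ)` for all `a, b ≤ c`, then the convolution
`∑_{a+b=c} u_a v_b ∈ Σ∧Σ∧((c+1)·t₁t₂(e₁+e₂+1), e₁+e₂, δ)` (Lemma 2.12 for `Σ∧Σ∧` termwise, then sums).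
[cite: DuttaDwivediSaxena2022, Lemma 2.12 with Remark (full version p0020 L549–557)] -/
theorem sum_antidiagonal_mul_mem_swswClass [CharZero K] {t₁ t₂ e₁ e₂ δ c : ℕ}
    {u v : ℕ → MvPolynomial (Fin n) K} (hu : ∀ a ≤ c, u a ∈ swswClass K n t₁ e₁ δ)
    (hv : ∀ b ≤ c, v b ∈ swswClass K n t₂ e₂ δ) :
    ∑ x ∈ antidiagonal c, u x.1 * v x.2 ∈
      swswClass K n ((c + 1) * (t₁ * t₂ * (e₁ + e₂ + 1))) (e₁ + e₂) δ := by
  have hcard : (antidiagonal c).card = c + 1 :=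
    Finset.Nat.card_antidiagonal c
  have h := sum_mem_swswClass (antidiagonal c) (fun x => u x.1 * v x.2)
    (t := t₁ * t₂ * (e₁ + e₂ + 1)) (e := e₁ + e₂) (δ := δ) fun x hx => by
      have hx' := mem_antidiagonal.1 hx
      exact mul_mem_swswClass (hu x.1 (by omega)) (hv x.2 (by omega))
  rwa [hcard] at h


/-! ### `Σ∧Σ∧` certificates for the graded pieces of the fractions and their propagation -/

namespace WFracPair

/-- The degree-`c` graded piece of the power series `p / den` (B4a `gcomp`).
[cite: DuttaDwivediSaxena2022, §3 Claim 3.6 proof via eq. (3.3), as transposed to §5 by Claim 5.2 (full version p0032 L854–871, p0044 L1164–1178)] -/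
def gc (P : WFracPair K n) (c : ℕ) : MvPolynomial (Fin n) K := gcomp P.p P.den c

/-- `gc_def`. [cite: DuttaDwivediSaxena2022, Claim 5.2 (full version p0044 L1164–1178)] -/
theorem gc_def (P : WFracPair K n) (c : ℕ) : P.gc c = gcomp P.p P.den c := rfl

/-- **`Σ∧Σ∧` certificate** of a fraction below degree `N`: every graded piece of degree `c < N` of
`p / den` is a `Σ∧Σ∧` circuit with `≤ t` summands, exponents `≤ e`, univariate degrees `≤ δ`
(Claim 5.2: "`T_{1,k−1} ∈ (ΠΣ∧/ΠΣ∧)·(Σ∧Σ∧/Σ∧Σ∧)` … of size at most `s^{O(k7^k)}`").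
[cite: DuttaDwivediSaxena2022, Claim 5.2 (full version p0044 L1164–1178)] -/
def WCert (N t e δ : ℕ) (P : WFracPair K n) : Prop :=
  ∀ c < N, P.gc c ∈ swswClass K n t e δ

/-- `WCert.mono`. [cite: DuttaDwivediSaxena2022, Claim 5.2 (full version p0044 L1164–1178)] -/
theorem WCert.mono {N t t' e e' δ : ℕ} {P : WFracPair K n} (h : P.WCert N t e δ) (ht : t ≤ t')
    (he : e ≤ e') : P.WCert N t' e' δ :=
  fun c hc => swswClass_mono ht he le_rfl (h c hc)

/-- `WCert.anti`. [cite: DuttaDwivediSaxena2022, Claim 5.2 (full version p0044 L1164–1178)] -/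
theorem WCert.anti {N N' t e δ : ℕ} {P : WFracPair K n} (h : P.WCert N t e δ) (hN : N' ≤ N) :
    P.WCert N' t e δ :=
  fun c hc => h c (lt_of_lt_of_le hc hN)

/-- `gc_mul` (convolution of graded pieces, B4a `gcomp_mul`).
[cite: DuttaDwivediSaxena2022, Lemma 2.12 Remark and Claim 5.2 (full version p0020 L556–557, p0044 L1172)] -/
theorem gc_mul (P Q : WFracPair K n) (c : ℕ) :
    (P.mul Q).gc c = ∑ ij ∈ antidiagonal c, P.gc ij.1 * Q.gc ij.2 := by
  rw [gc_def, mul_p, den_mul, gcomp_mul]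
  rfl

/-- **Products** ("`Σ∧Σ∧` is closed under multiplication (Lemma 2.12)", p0044 L1172).
[cite: DuttaDwivediSaxena2022, Lemma 2.12 Remark and Claim 5.2 (full version p0020 L556–557, p0044 L1172)] -/
theorem WCert.mul [CharZero K] {N t₁ t₂ e₁ e₂ δ : ℕ} {P Q : WFracPair K n}
    (hP : P.WCert N t₁ e₁ δ) (hQ : Q.WCert N t₂ e₂ δ) :
    (P.mul Q).WCert N (N * (t₁ * t₂ * (e₁ + e₂ + 1))) (e₁ + e₂) δ := by
  intro c hc
  rw [gc_mul]
  refine swswClass_mono ?_ le_rfl le_rfl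
    (sum_antidiagonal_mul_mem_swswClass (fun a ha => hP a (by omega)) (fun b hb => hQ b (by omega)))
  exact Nat.mul_le_mul_right _ hc

/-- `gc_add`. [cite: DuttaDwivediSaxena2022, Lemma 2.13 Remark (full version p0021 L560–568)] -/
theorem gc_add (P Q : WFracPair K n) (c : ℕ) : (P.add Q).gc c = P.gc c + Q.gc c := by
  rw [gc_def, add_p, den_add, gcomp_add _ _ P.coeff_zero_den_ne_zero Q.coeff_zero_den_ne_zero]
  rfl

/-- **Sums** (same exponent and degree budgets; fan-ins add).
[cite: DuttaDwivediSaxena2022, Lemma 2.13 Remark (full version p0021 L560–568)] -/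
theorem WCert.add {N t₁ t₂ e δ : ℕ} {P Q : WFracPair K n} (hP : P.WCert N t₁ e δ)
    (hQ : Q.WCert N t₂ e δ) : (P.add Q).WCert N (t₁ + t₂) e δ := by
  intro c hc
  rw [gc_add]
  exact add_mem_swswClass' (hP c hc) (hQ c hc)

/-- `gc_neg`. [cite: DuttaDwivediSaxena2022, Lemma 2.13 Remark (full version p0021 L560–568)] -/
theorem gc_neg (P : WFracPair K n) (c : ℕ) : P.neg.gc c = -P.gc c := by
  rw [gc_def, neg_p, den_neg, gcomp_neg_left]
  rfl

/-- `WCert.neg`. [cite: DuttaDwivediSaxena2022, Lemma 2.13 Remark (full version p0021 L560–568)] -/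
theorem WCert.neg {N t e δ : ℕ} {P : WFracPair K n} (hP : P.WCert N t e δ) : P.neg.WCert N t e δ := by
  intro c hc
  rw [gc_neg]
  exact neg_mem_swswClass (hP c hc)

/-- `WCert.sub`. [cite: DuttaDwivediSaxena2022, Lemma 2.13 Remark (full version p0021 L560–568)] -/
theorem WCert.sub {N t₁ t₂ e δ : ℕ} {P Q : WFracPair K n} (hP : P.WCert N t₁ e δ)
    (hQ : Q.WCert N t₂ e δ) : (P.sub Q).WCert N (t₁ + t₂) e δ :=
  WCert.add hP hQ.neg

/-- `gc_smul`. [cite: DuttaDwivediSaxena2022, Lemma 2.12 Remark (full version p0020 L556–557)] -/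
theorem gc_smul (a : K) (P : WFracPair K n) (c : ℕ) : (P.smul a).gc c = a • P.gc c := by
  rw [gc_def, smul_p, den_smul, gcomp_C_mul]
  rfl

/-- `WCert.smul`. [cite: DuttaDwivediSaxena2022, Lemma 2.12 Remark (full version p0020 L556–557)] -/
theorem WCert.smul {N t e δ : ℕ} (a : K) {P : WFracPair K n} (hP : P.WCert N t e δ) :
    (P.smul a).WCert N t e δ := by
  intro c hc
  rw [gc_smul, smul_eq_C_mul]
  exact C_mul_mem_swswClass a (hP c hc)

/-- Graded pieces of `E(p/den)`: `E` is diagonal of weight `c` in degree `c` (B4a `gcomp_euler`).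
[cite: DuttaDwivediSaxena2022, Lemma 2.15 Remark and Claim 5.2, "the derivative of Σ∧Σ∧ is again a Σ∧Σ∧ circuit" (full version p0022 L584, p0044 L1173–1174)] -/
theorem gc_der_euler (P : WFracPair K n) (c : ℕ) :
    (P.der (euler (Fin n) K)).gc c = (c : K) • P.gc c := by
  rw [gc_def, der_p, den_der, ← pow_two, gcomp_euler _ P.coeff_zero_den_ne_zero]
  rfl

/-- `WCert.der_euler`. [cite: DuttaDwivediSaxena2022, Lemma 2.15 Remark and Claim 5.2 (full version p0022 L584, p0044 L1173–1174)] -/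
theorem WCert.der_euler {N t e δ : ℕ} {P : WFracPair K n} (hP : P.WCert N t e δ) :
    (P.der (euler (Fin n) K)).WCert N t e δ := by
  intro c hc
  rw [gc_der_euler, smul_eq_C_mul]
  exact C_mul_mem_swswClass _ (hP c hc)

/-- The polynomial `1` has pieces `1, 0, 0, …`.
[cite: DuttaDwivediSaxena2022, §5 proof of Thm. 5.1, base case, `P = Q = 1` at stage 0 as in §3 (full version p0044 L1155–1158, p0028 L748–750)] -/
theorem gc_ofPoly_one (c : ℕ) :
    (ofPoly (1 : MvPolynomial (Fin n) K)).gc c = if c = 0 then 1 else 0 := by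
  rw [gc_def, den_ofPoly, ofPoly_p, gcomp_one]
  rcases Nat.eq_zero_or_pos c with rfl | hc
  · simp [homogeneousComponent_zero]
  · rw [if_neg hc.ne', homogeneousComponent_eq_zero]
    rw [totalDegree_one]
    exact hc

/-- `wcert_ofPoly_one`: the certificate of `1` (fan-in `1`, exponent `0`).
[cite: DuttaDwivediSaxena2022, §5 proof of Thm. 5.1, base case (full version p0044 L1155–1158)] -/
theorem wcert_ofPoly_one (N δ : ℕ) : (ofPoly (1 : MvPolynomial (Fin n) K)).WCert N 1 0 δ := by
  intro c _
  rw [gc_ofPoly_one]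
  split_ifs
  · exact swswClass_mono le_rfl le_rfl (Nat.zero_le _) one_mem_swswClass
  · exact zero_mem_swswClass 1 0 δ

end WFracPair


/-! ### Certificates for `dlog` of `ΠΣ∧` products: Claim 5.2 summed over the forms -/

/-- Budget arithmetic: the per-form `dlog` budget of `DDS21WedgeWedgeToolkit` below degree `N`. [folklore] -/
private theorem dlog_budget_le {c N δ : ℕ} (hc : c < N) :
    1 * (c + 1) * (1 + c + 1) * ((1 + c) * δ + 1) ≤ N * (N + 1) * (N * δ + 1) := by
  have h1 : c + 1 ≤ N := hc
  have h3 : (1 + c) * δ + 1 ≤ N * δ + 1 := by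
    have := Nat.mul_le_mul_right δ (show 1 + c ≤ N by omega)
    omega
  calc 1 * (c + 1) * (1 + c + 1) * ((1 + c) * δ + 1) = (c + 1) * (1 + c + 1) * ((1 + c) * δ + 1) := by
        ring
    _ ≤ N * (N + 1) * (N * δ + 1) := Nat.mul_le_mul (Nat.mul_le_mul h1 (by omega)) h3

/-- **`dlog(ΠΣ∧) ∈ Σ∧Σ∧`, graded and exact (DDS21 Claim 5.2)**: the degree-`c < N` piece of
`E(∏_L g)/∏_L g = ∑_{g ∈ L} Eg/g` is a `Σ∧Σ∧` circuit with top fan-in `≤ |L|·N(N+1)(Nδ+1)`,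
exponents `≤ N`, univariate degrees `≤ δ` (the per-form pieces are B6-1's
`gcomp_euler_wedgeForm_mem_swswClass`, "(3.3) can be written for `Σ∧` circuits, giving a `Σ∧Σ∧`
circuit").
[cite: DuttaDwivediSaxena2022, Claim 5.2 with proof (full version p0044 L1164–1175)] -/
theorem gcomp_euler_wformProd_mem_swswClass [CharZero K] {δ N : ℕ} {L : List (WForm K n)}
    (hL : ∀ a ∈ L, a.c0 ≠ 0) (hd : ∀ f ∈ L, f.DegLE δ) {c : ℕ} (hc : c < N) :
    gcomp (euler (Fin n) K (wformProd L)) (wformProd L) c ∈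
      swswClass K n (L.length * (N * (N + 1) * (N * δ + 1))) N δ := by
  induction L with
  | nil =>
    have h0 : euler (Fin n) K (wformProd ([] : List (WForm K n))) = 0 := by
      rw [wformProd_nil]; exact (euler (Fin n) K).map_one_eq_zero
    rw [h0, gcomp_zero]
    exact zero_mem_swswClass _ _ _
  | cons a L ih =>
    have ha : a.c0 ≠ 0 := hL a (by simp)
    have hda : a.DegLE δ := hd a (by simp)
    have hL' : ∀ b ∈ L, b.c0 ≠ 0 := fun b hb => hL b (by simp [hb])
    have hd' : ∀ f ∈ L, f.DegLE δ := fun f hf => hd f (by simp [hf])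
    have hℓ : coeff 0 a.val ≠ 0 := by rwa [WForm.coeff_zero_val]
    have hP0 : coeff 0 (wformProd L) ≠ 0 := coeff_zero_wformProd_ne_zero hL'
    rw [wformProd_cons, euler_mul, mul_comm a.val (euler (Fin n) K (wformProd L)),
      gcomp_add _ _ hℓ hP0, List.length_cons, Nat.succ_mul, Nat.add_comm]
    refine add_mem_swswClass' ?_ (ih hL' hd')
    have h0 : coeff 0 (wedgeForm a.a a.p) ≠ 0 := hℓ
    have hw := gcomp_euler_wedgeForm_mem_swswClass a.a hda h0 c
    exact swswClass_mono (dlog_budget_le hc) (by omega) le_rfl hw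

namespace WPiRatio

/-- **Certificate of `dlog` of a `ΠΣ∧`-ratio** ("it readily follows that `dlog(ΠΣ∧) ∈ Σ∧Σ∧`",
p0044 L1172–1173): below degree `N`, top fan-in `(|num| + |den|)·N(N+1)(Nδ+1)`, exponents `≤ N`.
[cite: DuttaDwivediSaxena2022, Claim 5.2 with proof (full version p0044 L1164–1175)] -/
theorem wcert_dlog [CharZero K] {δ : ℕ} (A : WPiRatio K n) (hA : A.DegForms δ) (N : ℕ) :
    (A.dlog (euler (Fin n) K)).WCert N
      ((A.num.length + A.den.length) * (N * (N + 1) * (N * δ + 1))) N δ := by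
  rw [Nat.add_mul]
  refine WFracPair.WCert.sub (P := ⟨euler (Fin n) K (wformProd A.num), A.num, A.hnum⟩)
    (Q := ⟨euler (Fin n) K (wformProd A.den), A.den, A.hden⟩) ?_ ?_
  · intro c hc; exact gcomp_euler_wformProd_mem_swswClass A.hnum hA.1 hc
  · intro c hc; exact gcomp_euler_wformProd_mem_swswClass A.hden hA.2 hc

end WPiRatio

/-! ### Certificates of exact terms and their propagation through the DiDIL step -/

/-- The top fan-in budget of `derT` (exactly what the propagation lemmas produce: the `dlog`
certificate times `𝒫𝒬`, plus `E𝒫·𝒬 − 𝒫·E𝒬`). [cite: DuttaDwivediSaxena2022, Claim 5.2 and "the size and degree claims remain the same" (full version p0044 L1164–1178, p0045 L1)] -/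
def wDerTop (N δ B t e : ℕ) : ℕ :=
  N * ((2 * B) * (N * (N + 1) * (N * δ + 1)) * (N * (t * t * (e + e + 1))) * (N + (e + e) + 1)) +
    (N * (t * t * (e + e + 1)) + N * (t * t * (e + e + 1)))

/-- The top fan-in budget of one DiDIL operation `didil = derT ∘ divT`.
[cite: DuttaDwivediSaxena2022, Claim 5.2 and "the size and degree claims remain the same" (full version p0044 L1164–1178, p0045 L1)] -/
def wDidilTop (N δ B t e : ℕ) : ℕ := wDerTop N δ (2 * B) (N * (t * t * (e + e + 1))) (e + e)

/-- The exponent budget of one DiDIL operation: `N + 4e`.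
[cite: DuttaDwivediSaxena2022, Claim 5.2 and "the size and degree claims remain the same" (full version p0044 L1164–1178, p0045 L1)] -/
def wDidilExp (N e : ℕ) : ℕ := N + ((e + e) + (e + e))

namespace WExactTerm

/-- `Σ∧Σ∧` certificate of an exact term: both fractions `𝒫, 𝒬` have `Σ∧Σ∧(t, e, δ)` graded pieces in
all degrees `c < N` (Claim 5.2's membership of the `Σ∧Σ∧/Σ∧Σ∧` part, graded/exact form).
[cite: DuttaDwivediSaxena2022, Claim 5.2 (full version p0044 L1164–1178)] -/
def WCert (N t e δ : ℕ) (T : WExactTerm K n) : Prop := T.P.WCert N t e δ ∧ T.Q.WCert N t e δ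

/-- `WCert.mono`. [cite: DuttaDwivediSaxena2022, Claim 5.2 (full version p0044 L1164–1178)] -/
theorem WCert.mono {N t t' e e' δ : ℕ} {T : WExactTerm K n} (h : T.WCert N t e δ) (ht : t ≤ t')
    (he : e ≤ e') : T.WCert N t' e' δ :=
  ⟨h.1.mono ht he, h.2.mono ht he⟩

/-- `wcert_ofForms`: a bare `ΠΣ∧` product has trivial certificates.
[cite: DuttaDwivediSaxena2022, §5 proof of Thm. 5.1, base case (full version p0044 L1155–1158)] -/
theorem wcert_ofForms (κ : K) (hκ : κ ≠ 0) (L : List (WForm K n))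
    (hL : ∀ a ∈ L, a.c0 ≠ 0) (N δ : ℕ) : (ofForms κ hκ L hL).WCert N 1 0 δ :=
  ⟨WFracPair.wcert_ofPoly_one N δ, WFracPair.wcert_ofPoly_one N δ⟩

/-- `WCert.smul`. [cite: DuttaDwivediSaxena2022, Claim 5.2 (full version p0044 L1164–1178)] -/
theorem WCert.smul {N t e δ : ℕ} (c : K) (hc : c ≠ 0) {T : WExactTerm K n} (h : T.WCert N t e δ) :
    (T.smul c hc).WCert N t e δ := h

/-- **Divide**: certificates multiply. [cite: DuttaDwivediSaxena2022, Claim 5.2, Divide step (full version p0044 L1162–1178)] -/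
theorem WCert.divT [CharZero K] {N t e δ : ℕ} {T S : WExactTerm K n} (hT : T.WCert N t e δ)
    (hS : S.WCert N t e δ) : (T.divT S).WCert N (N * (t * t * (e + e + 1))) (e + e) δ :=
  ⟨hT.1.mul hS.2, hT.2.mul hS.1⟩

/-- **Derive**: certificates propagate through `derT` with the `dlog(ΠΣ∧) ∈ Σ∧Σ∧` certificate of
Claim 5.2. [cite: DuttaDwivediSaxena2022, Claim 5.2 with proof (full version p0044 L1164–1178)] -/
theorem WCert.derT [CharZero K] {N t e δ B D : ℕ} {T : WExactTerm K n} (hT : T.WCert N t e δ)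
    (hB : T.WBdd δ B D) (hd : T.DegForms δ) :
    (T.derT (euler (Fin n) K)).WCert N (wDerTop N δ B t e) (N + (e + e)) δ := by
  obtain ⟨hP, hQ⟩ := hT
  obtain ⟨h1, h2, -, -, -, -, -⟩ := hB
  have hdl : (T.A.dlog (euler (Fin n) K)).WCert N ((2 * B) * (N * (N + 1) * (N * δ + 1))) N δ :=
    (T.A.wcert_dlog hd.1 N).mono (Nat.mul_le_mul_right _ (by omega)) le_rfl
  have hPQ : (T.P.mul T.Q).WCert N (N * (t * t * (e + e + 1))) (e + e) δ := hP.mul hQ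
  have hA := hdl.mul hPQ
  have hB1 : ((T.P.der (euler (Fin n) K)).mul T.Q).WCert N (N * (t * t * (e + e + 1))) (e + e) δ :=
    hP.der_euler.mul hQ
  have hB2 : (T.P.mul (T.Q.der (euler (Fin n) K))).WCert N (N * (t * t * (e + e + 1))) (e + e) δ :=
    hP.mul hQ.der_euler
  have hB12 := ((hB1.sub hB2).mono le_rfl (show e + e ≤ N + (e + e) by omega))
  have hnum := hA.add hB12
  have hden : (T.Q.mul T.Q).WCert N (N * (t * t * (e + e + 1))) (e + e) δ := hQ.mul hQ
  refine ⟨hnum, hden.mono ?_ (by omega)⟩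
  unfold wDerTop
  exact (Nat.le_add_right _ _).trans (Nat.le_add_left _ _)

/-- **One DiDIL operation** `didil = derT ∘ divT`: certificate `(wDidilTop, wDidilExp)`.
[cite: DuttaDwivediSaxena2022, Claim 5.2 with proof (full version p0044 L1164–1178)] -/
theorem WCert.didil [CharZero K] {N t e δ B D : ℕ} {T S : WExactTerm K n} (hT : T.WCert N t e δ)
    (hS : S.WCert N t e δ) (hTB : T.WBdd δ B D) (hSB : S.WBdd δ B D) (hTd : T.DegForms δ)
    (hSd : S.DegForms δ) :
    (didil (euler (Fin n) K) T S).WCert N (wDidilTop N δ B t e) (wDidilExp N e) δ :=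
  WCert.derT (hT.divT hS) (wbdd_divT hTB hSB) (degForms_divT hTd hSd)

end WExactTerm

/-- Certificates through one DiDIL step on a family.
[cite: DuttaDwivediSaxena2022, Claim 5.2 with proof (full version p0044 L1164–1178)] -/
theorem wcert_wdidilStep [CharZero K] {N t e δ B D m : ℕ} {G : Fin (m + 1) → WExactTerm K n}
    (hG : ∀ i, (G i).WCert N t e δ) (hB : ∀ i, (G i).WBdd δ B D) (hd : ∀ i, (G i).DegForms δ)
    (i₀ : Fin (m + 1)) (i : Fin m) :
    (wdidilStep (euler (Fin n) K) G i₀ i).WCert N (wDidilTop N δ B t e) (wDidilExp N e) δ :=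
  WExactTerm.WCert.didil (hG _) (hG _) (hB _) (hB _) (hd _) (hd _)

/-! ### The Euler instance of the exact identity -/

/-- **DiDIL step for the `Σ∧` bloated model, Euler form (eq. (3.2) exact, graded frame)**:
`Σ_{i ≠ i₀} E(T_i/T_{i₀}) = E((Σ_i T_i)/T_{i₀})` for the Euler derivation of `K(x)` (B4b's
`extendsDer_eulerFrac` BY NAME). [cite: DuttaDwivediSaxena2022, §5 proof of Thm. 5.1, "We will apply again divide and derive" (full version p0044 L1162–1163)] -/
theorem sum_val_wdidilStep_euler {m : ℕ} (G : Fin (m + 1) → WExactTerm K n) (hG : ∀ i, (G i).WF)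
    (i₀ : Fin (m + 1)) (h : (G i₀).ND) :
    ∑ i, (wdidilStep (euler (Fin n) K) G i₀ i).val =
      eulerFrac (Fin n) K (FractionRing (MvPolynomial (Fin n) K)) ((∑ i, (G i).val) / (G i₀).val) :=
  sum_val_wdidilStep extendsDer_eulerFrac G hG i₀ h


/-! ### Iterating the step: `j` DiDIL rounds with a divisor-choice rule (twin of B4b §7) -/

/-- A DIVISOR-CHOICE RULE for the `Σ∧` bloated model (twin of B4b `Choice`).
[cite: DuttaDwivediSaxena2022, §5 proof of Thm. 5.1, "We will apply again divide and derive to reduce the fan-in step by step" (full version p0044 L1162–1163)] -/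
def WChoice (K : Type*) [Field K] (n : ℕ) : Type _ :=
  ∀ m : ℕ, (Fin (m + 1) → WExactTerm K n) → Fin (m + 1)

/-- The rule "always divide by the last term". [cite: DuttaDwivediSaxena2022, §5 proof of Thm. 5.1 (full version p0044 L1162–1163)] -/
def WChoice.last : WChoice K n := fun m _ => Fin.last m

/-- **`j` rounds of DiDIL** on a family of `m + j` terms (twin of B4b `didilIter`).
[cite: DuttaDwivediSaxena2022, §5 proof of Thm. 5.1, the induction on the top fan-in (full version p0043 L1153–1154, p0044 L1162–1163)] -/
def wdidilIter (E₀ : Derivation K (MvPolynomial (Fin n) K) (MvPolynomial (Fin n) K)) (c : WChoice K n)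
    (m : ℕ) : (j : ℕ) → (Fin (m + j) → WExactTerm K n) → (Fin m → WExactTerm K n)
  | 0, G => G
  | j + 1, G => wdidilIter E₀ c m j (wdidilStep E₀ G (c (m + j) G))

/-- `wdidilIter_zero`. [cite: DuttaDwivediSaxena2022, §5 proof of Thm. 5.1 (full version p0044 L1162–1163)] -/
@[simp] theorem wdidilIter_zero (E₀ : Derivation K (MvPolynomial (Fin n) K) (MvPolynomial (Fin n) K))
    (c : WChoice K n) (m : ℕ) (G : Fin (m + 0) → WExactTerm K n) : wdidilIter E₀ c m 0 G = G := rfl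

/-- `wdidilIter_succ`. [cite: DuttaDwivediSaxena2022, §5 proof of Thm. 5.1 (full version p0044 L1162–1163)] -/
theorem wdidilIter_succ (E₀ : Derivation K (MvPolynomial (Fin n) K) (MvPolynomial (Fin n) K))
    (c : WChoice K n) (m j : ℕ) (G : Fin (m + (j + 1)) → WExactTerm K n) :
    wdidilIter E₀ c m (j + 1) G = wdidilIter E₀ c m j (wdidilStep E₀ G (c (m + j) G)) := rfl

/-- The divisors met along the iteration are nondegenerate (twin of B4b `DivisorsND`).
[cite: DuttaDwivediSaxena2022, §5 proof of Thm. 5.1, "the bottom Σ∧ circuits are 'invertible'" (full version p0044 L1160–1163)] -/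
def WDivisorsND (E₀ : Derivation K (MvPolynomial (Fin n) K) (MvPolynomial (Fin n) K)) (c : WChoice K n)
    (m : ℕ) : (j : ℕ) → (Fin (m + j) → WExactTerm K n) → Prop
  | 0, _ => True
  | j + 1, G => (G (c (m + j) G)).ND ∧ WDivisorsND E₀ c m j (wdidilStep E₀ G (c (m + j) G))

/-- Well-formedness along the iteration. [cite: DuttaDwivediSaxena2022, §5 proof of Thm. 5.1 (full version p0044 L1160–1163)] -/
theorem wf_wdidilIter (E₀ : Derivation K (MvPolynomial (Fin n) K) (MvPolynomial (Fin n) K))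
    (c : WChoice K n) (m : ℕ) :
    ∀ (j : ℕ) (G : Fin (m + j) → WExactTerm K n), (∀ i, (G i).WF) → WDivisorsND E₀ c m j G →
      ∀ i, (wdidilIter E₀ c m j G i).WF
  | 0, _, hG, _ => hG
  | j + 1, G, hG, hD => by
    rw [wdidilIter_succ]
    exact wf_wdidilIter E₀ c m j _ (fun i => wf_wdidilStep E₀ hG hD.1 i) hD.2

/-- The univariate-degree invariant along the iteration (forms are never created).
[cite: DuttaDwivediSaxena2022, §5 proof of Thm. 5.1, "the size and degree claims remain the same" (full version p0045 L1)] -/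
theorem degForms_wdidilIter {δ : ℕ}
    (E₀ : Derivation K (MvPolynomial (Fin n) K) (MvPolynomial (Fin n) K)) (c : WChoice K n) (m : ℕ) :
    ∀ (j : ℕ) (G : Fin (m + j) → WExactTerm K n), (∀ i, (G i).DegForms δ) →
      ∀ i, (wdidilIter E₀ c m j G i).DegForms δ
  | 0, _, hG => hG
  | j + 1, G, hG => by
    rw [wdidilIter_succ]
    exact degForms_wdidilIter E₀ c m j _ (fun i => degForms_wdidilStep E₀ hG _ i)

/-- Sizes along the iteration: `(20^j · B, 20^j · D)`.
[cite: DuttaDwivediSaxena2022, §5 proof of Thm. 5.1, "the size and degree claims remain the same", with Claim 3.6 (full version p0045 L1, p0033 L880–887)] -/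
theorem wbdd_wdidilIter {E₀ : Derivation K (MvPolynomial (Fin n) K) (MvPolynomial (Fin n) K)}
    (hE : DegLE E₀) {δ : ℕ} (c : WChoice K n) (m : ℕ) :
    ∀ (j : ℕ) {B D : ℕ} (G : Fin (m + j) → WExactTerm K n), (∀ i, (G i).WBdd δ B D) →
      (∀ i, (G i).DegForms δ) → ∀ i, (wdidilIter E₀ c m j G i).WBdd δ (20 ^ j * B) (20 ^ j * D)
  | 0, B, D, G, hG, _, i => by simpa using hG i
  | j + 1, B, D, G, hG, hd, i => by
    rw [wdidilIter_succ]
    have h := wbdd_wdidilIter hE c m j (B := 20 * B) (D := 20 * D) (wdidilStep E₀ G (c (m + j) G))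
      (fun i => wbdd_wdidilStep hE hG hd _ i) (fun i => degForms_wdidilStep E₀ hd _ i) i
    rw [pow_succ, mul_assoc, mul_assoc]
    exact h.mono (le_of_eq (by ring)) (le_of_eq (by ring)) (le_of_eq (by ring) |>.trans h.2.2.2.2.2.2
      |>.trans (le_of_eq (by ring)))

/-- The explicit top-fan-in tower of the iterated certificates:
`wcertTop N δ t e B (j+1) = wcertTop N δ (wDidilTop N δ B t e) (wDidilExp N e) (20B) j`.
[cite: DuttaDwivediSaxena2022, Claim 5.2, size `s^{O(k 7^k)}` (full version p0044 L1164–1165, L1176–1178)] -/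
def wcertTop (N δ : ℕ) : ℕ → ℕ → ℕ → ℕ → ℕ
  | t, _, _, 0 => t
  | t, e, B, j + 1 => wcertTop N δ (wDidilTop N δ B t e) (wDidilExp N e) (20 * B) j

/-- The explicit exponent tower: `wcertExp N e (j+1) = wcertExp N (N + 4e) j`.
[cite: DuttaDwivediSaxena2022, Claim 5.2, size `s^{O(k 7^k)}` (full version p0044 L1164–1165, L1176–1178)] -/
def wcertExp (N : ℕ) : ℕ → ℕ → ℕ
  | e, 0 => e
  | e, j + 1 => wcertExp N (wDidilExp N e) j

/-- `wcertTop_zero`. [cite: DuttaDwivediSaxena2022, Claim 5.2 (full version p0044 L1164–1178)] -/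
@[simp] theorem wcertTop_zero (N δ t e B : ℕ) : wcertTop N δ t e B 0 = t := rfl

/-- `wcertTop_succ`. [cite: DuttaDwivediSaxena2022, Claim 5.2 (full version p0044 L1164–1178)] -/
theorem wcertTop_succ (N δ t e B j : ℕ) :
    wcertTop N δ t e B (j + 1) = wcertTop N δ (wDidilTop N δ B t e) (wDidilExp N e) (20 * B) j := rfl

/-- `wcertExp_zero`. [cite: DuttaDwivediSaxena2022, Claim 5.2 (full version p0044 L1164–1178)] -/
@[simp] theorem wcertExp_zero (N e : ℕ) : wcertExp N e 0 = e := rfl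

/-- `wcertExp_succ`. [cite: DuttaDwivediSaxena2022, Claim 5.2 (full version p0044 L1164–1178)] -/
theorem wcertExp_succ (N e j : ℕ) : wcertExp N e (j + 1) = wcertExp N (wDidilExp N e) j := rfl

/-- **Certificates along the iteration** (Euler frame): after `j` rounds every term carries a
`Σ∧Σ∧(wcertTop N δ t e B j, wcertExp N e j, δ)` certificate below degree `N`.
[cite: DuttaDwivediSaxena2022, Claim 5.2 with proof (full version p0044 L1164–1178)] -/
theorem wcert_wdidilIter [CharZero K] {δ : ℕ} (c : WChoice K n) (m : ℕ) :
    ∀ (j : ℕ) {N t e B D : ℕ} (G : Fin (m + j) → WExactTerm K n), (∀ i, (G i).WCert N t e δ) →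
      (∀ i, (G i).WBdd δ B D) → (∀ i, (G i).DegForms δ) →
      ∀ i, (wdidilIter (euler (Fin n) K) c m j G i).WCert N (wcertTop N δ t e B j) (wcertExp N e j) δ
  | 0, N, t, e, B, D, G, hG, _, _, i => by simpa [wcertTop, wcertExp] using hG i
  | j + 1, N, t, e, B, D, G, hG, hB, hd, i => by
    rw [wdidilIter_succ]
    exact wcert_wdidilIter c m j (wdidilStep (euler (Fin n) K) G (c (m + j) G))
      (fun i => wcert_wdidilStep hG hB hd _ i) (fun i => wbdd_wdidilStep degLE_euler hB hd _ i)
      (fun i => degForms_wdidilStep _ hd _ i) i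

/-- **Values along the iteration** (one round): eq. (3.2) for the `Σ∧` bloated model.
[cite: DuttaDwivediSaxena2022, §5 proof of Thm. 5.1, "We will apply again divide and derive" (full version p0044 L1162–1163)] -/
theorem sum_val_wdidilIter_succ {E₀ : Derivation K (MvPolynomial (Fin n) K) (MvPolynomial (Fin n) K)}
    {D : Derivation K (FractionRing (MvPolynomial (Fin n) K))
      (FractionRing (MvPolynomial (Fin n) K))}
    (hD : ExtendsDer K n E₀ D) (c : WChoice K n) (m j : ℕ) (G : Fin (m + (j + 1)) → WExactTerm K n)
    (hG : ∀ i, (G i).WF) (h : (G (c (m + j) G)).ND) :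
    ∑ i, (wdidilStep E₀ G (c (m + j) G) i).val = D ((∑ i, (G i).val) / (G (c (m + j) G)).val) :=
  sum_val_wdidilStep hD G hG _ h

/-! ### Stage `0`: the live terms of a `Σ^{[k]}ΠΣ∧` circuit as exact terms -/

/-- A product term `∏_j g_j` of `Σ∧` forms is LIVE if all its forms have nonzero constant
coefficient (after the generic shift every nonzero `Σ∧` form does).
[cite: DuttaDwivediSaxena2022, §5 proof of Thm. 5.1, "since α_i are random, the bottom Σ∧ circuits are 'invertible'" (full version p0044 L1159–1161)] -/
def WLiveTerm {d : ℕ} (α : Fin d → WForm K n) : Prop := ∀ j, (α j).c0 ≠ 0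

/-- A live product term as an exact term `1 · ∏_j g_j` with `𝒫 = 𝒬 = 1`.
[cite: DuttaDwivediSaxena2022, §5 proof of Thm. 5.1, base case (full version p0044 L1155–1161)] -/
def wofLiveTerm {d : ℕ} (α : Fin d → WForm K n) (h : WLiveTerm α) : WExactTerm K n :=
  WExactTerm.ofForms 1 one_ne_zero (List.ofFn α) (fun a ha => by
    obtain ⟨j, rfl⟩ := List.mem_ofFn.1 ha
    exact h j)

/-- `val_wofLiveTerm`. [cite: DuttaDwivediSaxena2022, §5 proof of Thm. 5.1, base case (full version p0044 L1155–1161)] -/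
theorem val_wofLiveTerm {d : ℕ} (α : Fin d → WForm K n) (h : WLiveTerm α) :
    (wofLiveTerm α h).val =
      algebraMap (MvPolynomial (Fin n) K) (FractionRing (MvPolynomial (Fin n) K))
        (∏ j, (α j).val) := by
  rw [wofLiveTerm, WExactTerm.val_ofForms, C_1, one_mul, wformProd_ofFn]

/-- `wf_wofLiveTerm`. [cite: DuttaDwivediSaxena2022, §5 proof of Thm. 5.1, base case (full version p0044 L1155–1161)] -/
theorem wf_wofLiveTerm {d : ℕ} (α : Fin d → WForm K n) (h : WLiveTerm α) : (wofLiveTerm α h).WF :=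
  WExactTerm.wf_ofForms _ _ _ _

/-- `nd_wofLiveTerm`. [cite: DuttaDwivediSaxena2022, §5 proof of Thm. 5.1, base case (full version p0044 L1155–1161)] -/
theorem nd_wofLiveTerm {d : ℕ} (α : Fin d → WForm K n) (h : WLiveTerm α) : (wofLiveTerm α h).ND :=
  WExactTerm.nd_ofForms _ _ _ _

/-- `wbdd_wofLiveTerm`: sizes `(d, δ·d)`. [cite: DuttaDwivediSaxena2022, §5 proof of Thm. 5.1, base case (full version p0044 L1155–1161)] -/
theorem wbdd_wofLiveTerm (δ : ℕ) {d : ℕ} (α : Fin d → WForm K n) (h : WLiveTerm α) :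
    (wofLiveTerm α h).WBdd δ d (δ * d) := by
  have hb := WExactTerm.wbdd_ofForms δ 1 one_ne_zero (List.ofFn α) (fun a ha => by
    obtain ⟨j, rfl⟩ := List.mem_ofFn.1 ha
    exact h j)
  rw [List.length_ofFn] at hb
  exact hb

/-- `degForms_wofLiveTerm`. [cite: DuttaDwivediSaxena2022, §5 proof of Thm. 5.1, base case (full version p0044 L1155–1161)] -/
theorem degForms_wofLiveTerm {δ d : ℕ} (α : Fin d → WForm K n) (h : WLiveTerm α)
    (hd : ∀ j, (α j).DegLE δ) : (wofLiveTerm α h).DegForms δ :=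
  WExactTerm.degForms_ofForms _ _ _ _ fun f hf => by
    obtain ⟨j, rfl⟩ := List.mem_ofFn.1 hf
    exact hd j

/-- `wcert_wofLiveTerm`. [cite: DuttaDwivediSaxena2022, §5 proof of Thm. 5.1, base case (full version p0044 L1155–1161)] -/
theorem wcert_wofLiveTerm {d : ℕ} (α : Fin d → WForm K n) (h : WLiveTerm α) (N δ : ℕ) :
    (wofLiveTerm α h).WCert N 1 0 δ :=
  WExactTerm.wcert_ofForms _ _ _ _ N δ

end DDS2021

end Literature.Computability.AlgebraicComplexity

namespace Literature.Computability.AlgebraicComplexity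

namespace DDS2021

variable {K : Type*} [Field K] {n : ℕ}

/-! ## Provenance of the forms (twin of B4b §8) and stage `0` with provenance and shape -/

section Provenance

namespace WExactTerm

/-- "All `Σ∧` forms of the term `T` (in `A.num`, `A.den`, `𝒫.L`, `𝒬.L`) satisfy `P`."
[cite: DuttaDwivediSaxena2022, §5 proof of Thm. 5.1 with §3 "Invertibility of ΠΣ-circuits" (full version p0044 L1159–1163, p0031 L836–845)] -/
def FormsSat (P : WForm K n → Prop) (T : WExactTerm K n) : Prop :=
  (∀ a ∈ T.A.num, P a) ∧ (∀ a ∈ T.A.den, P a) ∧ (∀ a ∈ T.P.L, P a) ∧ (∀ a ∈ T.Q.L, P a)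

/-- `formsSat_iff_forall_append`. [cite: DuttaDwivediSaxena2022, §5 proof of Thm. 5.1 (full version p0044 L1159–1163)] -/
theorem formsSat_iff_forall_append (P : WForm K n → Prop) (T : WExactTerm K n) :
    T.FormsSat P ↔ ∀ a ∈ T.A.num ++ T.A.den ++ T.P.L ++ T.Q.L, P a := by
  simp only [FormsSat, List.mem_append, or_imp, forall_and]
  tauto

/-- `FormsSat.imp`. [cite: DuttaDwivediSaxena2022, §5 proof of Thm. 5.1 (full version p0044 L1159–1163)] -/
theorem FormsSat.imp {P P' : WForm K n → Prop} (h : ∀ a, P a → P' a) {T : WExactTerm K n}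
    (hT : T.FormsSat P) : T.FormsSat P' :=
  ⟨fun a ha => h a (hT.1 a ha), fun a ha => h a (hT.2.1 a ha), fun a ha => h a (hT.2.2.1 a ha),
    fun a ha => h a (hT.2.2.2 a ha)⟩

/-- The degree invariant is a `FormsSat`. [cite: DuttaDwivediSaxena2022, §5 proof of Thm. 5.1 (full version p0045 L1)] -/
theorem degForms_iff_formsSat (δ : ℕ) (T : WExactTerm K n) :
    T.DegForms δ ↔ T.FormsSat fun f => f.DegLE δ := by
  simp only [DegForms, FormsSat, WPiRatio.DegForms, WFracPair.DegForms, and_assoc]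

/-- `formsSat_ofForms`. [cite: DuttaDwivediSaxena2022, §5 proof of Thm. 5.1 (full version p0044 L1155–1163)] -/
theorem formsSat_ofForms {P : WForm K n → Prop} (κ : K) (hκ : κ ≠ 0)
    (L : List (WForm K n)) (hL : ∀ a ∈ L, a.c0 ≠ 0) (hP : ∀ a ∈ L, P a) :
    (ofForms κ hκ L hL).FormsSat P := by
  refine ⟨hP, ?_, ?_, ?_⟩ <;> simp [ofForms, WFracPair.ofPoly]

/-- `FormsSat.smul`. [cite: DuttaDwivediSaxena2022, §5 proof of Thm. 5.1 (full version p0044 L1159–1163)] -/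
theorem FormsSat.smul {P : WForm K n → Prop} (c : K) (hc : c ≠ 0) {T : WExactTerm K n}
    (hT : T.FormsSat P) : (T.smul c hc).FormsSat P :=
  hT

/-- `divT_A_num`. [cite: DuttaDwivediSaxena2022, §5 proof of Thm. 5.1 (full version p0044 L1159–1163)] -/
theorem divT_A_num (T S : WExactTerm K n) : (T.divT S).A.num = T.A.num ++ S.A.den := rfl

/-- `divT_A_den`. [cite: DuttaDwivediSaxena2022, §5 proof of Thm. 5.1 (full version p0044 L1159–1163)] -/
theorem divT_A_den (T S : WExactTerm K n) : (T.divT S).A.den = T.A.den ++ S.A.num := rfl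

/-- `divT_P_L`. [cite: DuttaDwivediSaxena2022, §5 proof of Thm. 5.1 (full version p0044 L1159–1163)] -/
theorem divT_P_L (T S : WExactTerm K n) : (T.divT S).P.L = T.P.L ++ S.Q.L := rfl

/-- `divT_Q_L`. [cite: DuttaDwivediSaxena2022, §5 proof of Thm. 5.1 (full version p0044 L1159–1163)] -/
theorem divT_Q_L (T S : WExactTerm K n) : (T.divT S).Q.L = T.Q.L ++ S.P.L := rfl

/-- `derT_A`. [cite: DuttaDwivediSaxena2022, §5 proof of Thm. 5.1 (full version p0044 L1162–1163)] -/
theorem derT_A (E₀ : Derivation K (MvPolynomial (Fin n) K) (MvPolynomial (Fin n) K))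
    (T : WExactTerm K n) : (T.derT E₀).A = T.A := rfl

/-- `derT_P_L`. [cite: DuttaDwivediSaxena2022, §5 proof of Thm. 5.1 (full version p0044 L1162–1163)] -/
theorem derT_P_L (E₀ : Derivation K (MvPolynomial (Fin n) K) (MvPolynomial (Fin n) K))
    (T : WExactTerm K n) :
    (T.derT E₀).P.L = T.A.num ++ T.A.den ++ (T.P.L ++ T.Q.L) ++
      (T.P.L ++ T.P.L ++ T.Q.L ++ (T.P.L ++ (T.Q.L ++ T.Q.L))) := rfl

/-- `derT_Q_L`. [cite: DuttaDwivediSaxena2022, §5 proof of Thm. 5.1 (full version p0044 L1162–1163)] -/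
theorem derT_Q_L (E₀ : Derivation K (MvPolynomial (Fin n) K) (MvPolynomial (Fin n) K))
    (T : WExactTerm K n) : (T.derT E₀).Q.L = T.Q.L ++ T.Q.L := rfl

/-- **Closure under `divT`**. [cite: DuttaDwivediSaxena2022, §5 proof of Thm. 5.1 (full version p0044 L1159–1163)] -/
theorem FormsSat.divT {P : WForm K n → Prop} {T S : WExactTerm K n} (hT : T.FormsSat P)
    (hS : S.FormsSat P) : (T.divT S).FormsSat P := by
  obtain ⟨hTn, hTd, hTP, hTQ⟩ := hT
  obtain ⟨hSn, hSd, hSP, hSQ⟩ := hS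
  refine ⟨fun a ha => ?_, fun a ha => ?_, fun a ha => ?_, fun a ha => ?_⟩
  · rw [divT_A_num, List.mem_append] at ha
    exact ha.elim (hTn a) (hSd a)
  · rw [divT_A_den, List.mem_append] at ha
    exact ha.elim (hTd a) (hSn a)
  · rw [divT_P_L, List.mem_append] at ha
    exact ha.elim (hTP a) (hSQ a)
  · rw [divT_Q_L, List.mem_append] at ha
    exact ha.elim (hTQ a) (hSP a)

/-- **Closure under `derT`**. [cite: DuttaDwivediSaxena2022, §5 proof of Thm. 5.1 (full version p0044 L1162–1163)] -/
theorem FormsSat.derT {P : WForm K n → Prop}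
    (E₀ : Derivation K (MvPolynomial (Fin n) K) (MvPolynomial (Fin n) K)) {T : WExactTerm K n}
    (hT : T.FormsSat P) : (T.derT E₀).FormsSat P := by
  obtain ⟨hTn, hTd, hTP, hTQ⟩ := hT
  refine ⟨fun a ha => ?_, fun a ha => ?_, fun a ha => ?_, fun a ha => ?_⟩
  · rw [derT_A] at ha
    exact hTn a ha
  · rw [derT_A] at ha
    exact hTd a ha
  · simp only [derT_P_L, List.mem_append] at ha
    rcases ha with ((ha | ha) | (ha | ha)) | (((ha | ha) | ha) | (ha | (ha | ha)))
    all_goals first | exact hTn a ha | exact hTd a ha | exact hTP a ha | exact hTQ a ha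
  · rw [derT_Q_L, List.mem_append] at ha
    exact ha.elim (hTQ a) (hTQ a)

/-- **Closure under one DiDIL operation**. [cite: DuttaDwivediSaxena2022, §5 proof of Thm. 5.1 (full version p0044 L1162–1163)] -/
theorem FormsSat.didil {P : WForm K n → Prop}
    (E₀ : Derivation K (MvPolynomial (Fin n) K) (MvPolynomial (Fin n) K)) {T S : WExactTerm K n}
    (hT : T.FormsSat P) (hS : S.FormsSat P) : (didil E₀ T S).FormsSat P :=
  (hT.divT hS).derT E₀

end WExactTerm

/-- **Closure under one DiDIL step** on a family. [cite: DuttaDwivediSaxena2022, §5 proof of Thm. 5.1 (full version p0044 L1162–1163)] -/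
theorem formsSat_wdidilStep {P : WForm K n → Prop}
    (E₀ : Derivation K (MvPolynomial (Fin n) K) (MvPolynomial (Fin n) K)) {m : ℕ}
    {G : Fin (m + 1) → WExactTerm K n} (hG : ∀ i, (G i).FormsSat P) (i₀ : Fin (m + 1)) (i : Fin m) :
    (wdidilStep E₀ G i₀ i).FormsSat P :=
  (hG _).didil E₀ (hG _)

/-- **Closure under the DiDIL iteration**. [cite: DuttaDwivediSaxena2022, §5 proof of Thm. 5.1 (full version p0044 L1162–1163)] -/
theorem formsSat_wdidilIter {P : WForm K n → Prop}
    (E₀ : Derivation K (MvPolynomial (Fin n) K) (MvPolynomial (Fin n) K)) (c : WChoice K n) (m : ℕ) :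
    ∀ (j : ℕ) (G : Fin (m + j) → WExactTerm K n), (∀ i, (G i).FormsSat P) →
      ∀ i, (wdidilIter E₀ c m j G i).FormsSat P
  | 0, _, hG => hG
  | j + 1, G, hG => by
    rw [wdidilIter_succ]
    exact formsSat_wdidilIter E₀ c m j _ (fun i => formsSat_wdidilStep E₀ hG _ i)

/-- `formsSat_wofLiveTerm`. [cite: DuttaDwivediSaxena2022, §5 proof of Thm. 5.1, base case (full version p0044 L1155–1161)] -/
theorem formsSat_wofLiveTerm {P : WForm K n → Prop} {d : ℕ}
    (α : Fin d → WForm K n) (h : WLiveTerm α) (hα : ∀ j, P (α j)) :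
    (wofLiveTerm α h).FormsSat P :=
  WExactTerm.formsSat_ofForms _ _ _ _ fun a ha => by
    obtain ⟨j, rfl⟩ := List.mem_ofFn.1 ha
    exact hα j

/-- **Stage `0` of DiDIL for `Σ^{[k]}ΠΣ∧`, as data, with provenance and shape**: if every
NONZERO `Σ∧` form `g_{ij}` of the circuit `∑_i ∏_j g_{ij}` has a nonzero constant coefficient (the
generic-shift hypothesis, "since `α_i` are random, the bottom `Σ∧` circuits are 'invertible'",
p0044 L1160), then its value is the sum of `m ≤ k` well-formed, nondegenerate exact terms of size
`(d, δ·d)` with trivial certificates, whose forms are among the `g_{ij}` and which ARE the live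
products (twin of B4b `exists_stageZero_ofLiveTerm`).
[cite: DuttaDwivediSaxena2022, §5 proof of Thm. 5.1, base case and "Reducing the problem to k−1" (full version p0044 L1155–1163)] -/
theorem exists_wstageZero {k d δ : ℕ} (α : Fin k → Fin d → WForm K n)
    (hα : ∀ i j, (α i j).val ≠ 0 → (α i j).c0 ≠ 0) (hd : ∀ i j, (α i j).DegLE δ) :
    ∃ (m : ℕ) (G : Fin m → WExactTerm K n), m ≤ k ∧
      (∀ i, (G i).WF ∧ (G i).ND ∧ (G i).WBdd δ d (δ * d) ∧ (G i).DegForms δ ∧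
        ∀ N, (G i).WCert N 1 0 δ) ∧
      (∀ i, (G i).FormsSat fun a => ∃ i' j, a = α i' j) ∧
      (∀ i, ∃ (i' : Fin k) (h : WLiveTerm (α i')), G i = wofLiveTerm (α i') h) ∧
      ∑ i, (G i).val =
        algebraMap (MvPolynomial (Fin n) K) (FractionRing (MvPolynomial (Fin n) K))
          (∑ i, ∏ j, (α i j).val) := by
  classical
  set s : Finset (Fin k) := Finset.univ.filter fun i => WLiveTerm (α i) with hs
  have hmem : ∀ x : s, WLiveTerm (α x) := fun x => (Finset.mem_filter.1 x.2).2
  refine ⟨s.card, fun i => wofLiveTerm (α (s.equivFin.symm i)) (hmem _), ?_, ?_, ?_, ?_, ?_⟩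
  · exact (Finset.card_filter_le _ _).trans (by simp)
  · intro i
    exact ⟨wf_wofLiveTerm _ _, nd_wofLiveTerm _ _, wbdd_wofLiveTerm δ _ _,
      degForms_wofLiveTerm _ _ (fun j => hd _ j), fun N => wcert_wofLiveTerm _ _ N δ⟩
  · intro i
    exact formsSat_wofLiveTerm _ _ fun j => ⟨_, j, rfl⟩
  · intro i
    exact ⟨_, hmem _, rfl⟩
  · have h1 : ∑ i : Fin s.card, (wofLiveTerm (α (s.equivFin.symm i)) (hmem _)).val =
        ∑ x : s, (wofLiveTerm (α x) (hmem x)).val :=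
      Equiv.sum_comp s.equivFin.symm (fun x : s => (wofLiveTerm (α x) (hmem x)).val)
    rw [h1]
    have h2 : ∑ x : s, (wofLiveTerm (α x) (hmem x)).val =
        ∑ x ∈ s, algebraMap (MvPolynomial (Fin n) K) (FractionRing (MvPolynomial (Fin n) K))
          (∏ j, (α x j).val) := by
      rw [← Finset.sum_coe_sort s]
      exact Finset.sum_congr rfl fun x _ => val_wofLiveTerm _ _
    rw [h2, map_sum, hs, Finset.sum_filter]
    refine Finset.sum_congr rfl fun i _ => ?_
    split_ifs with hi
    · rfl
    · obtain ⟨j, hj⟩ : ∃ j, ¬ (α i j).c0 ≠ 0 := by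
        by_contra hc
        push Not at hc
        exact hi fun j => by simpa using hc j
      have hz : (α i j).val = 0 := by
        by_contra hne
        exact hj (hα i j hne)
      rw [Finset.prod_eq_zero (Finset.mem_univ j) hz, map_zero]

/-- **Stage `0` from `Σ^{[k]}ΠΣ∧` normal-form data** (`spswClass`'s `c : Fin k → Fin d → K`,
`p : Fin k → Fin d → Fin n → K[X]`): the circuit's value `∑_i ∏_j (c_{ij} + ∑_m p_{ijm}(x_m))` is
`∑_i ∏_j (α i j).val` for the forms `α i j := ⟨c i j, p i j⟩`.
[cite: DuttaDwivediSaxena2022, §5 Thm. 5.1, the class `Σ^{[k]}ΠΣ∧` (full version p0043 L1144–1150)] -/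
theorem sum_prod_eq_sum_prod_val {k d : ℕ} (c : Fin k → Fin d → K)
    (p : Fin k → Fin d → Fin n → Polynomial K) :
    (∑ i, ∏ j, (C (c i j) + ∑ m, Polynomial.aeval (X m : MvPolynomial (Fin n) K) (p i j m))) =
      ∑ i, ∏ j, (WForm.mk (c i j) (p i j) : WForm K n).val := rfl

end Provenance

end DDS2021

end Literature.Computability.AlgebraicComplexity
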